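import Literature.AlgebraicGeometry.Shioda1982.HodgeQuadruplesTwoThreePowerStep
import Literature.AlgebraicGeometry.Shioda1982.ExceptionalQuadruplesCompleteLeOneHundredEighty
import Mathlib.NumberTheory.Padics.PadicVal.Basic
import HarnessLib

/-!
# Hodge quadruples at the levels `m = 2ᵃ3ᵇ` (`a, b ≥ 2`): no mixed quadruple, the induction on the level, `Δ(2ᵃ3ᵇ) = 0`

Topic `Literature/AlgebraicGeometry/Shioda1982`. One definition of record (`StdOrSmall`, the statement `T(L)` carried through
the induction), private helper definitions with bodies, and THEOREMS; no named fact, no `sorry`. Third file of the series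
treating [Aoki1983, Thm. C] = [AokiShioda1983, Thm. (𝔅²ₘ) (ii)] = [Shioda1982PicardFermat, Prop. 4 (Q′)] ("for `m > 180` every
indecomposable primitive element of `𝔅²ₘ` is one of `αᵢ, βᵢ` (`m = 2m′`), `γⱼ` (`m = 3m″`)") at the levels `m = 2ᵃ3ᵇ` (cell
`pub-hfermat`, LIT lane), after part I (`HodgeQuadruplesTwoThreePower`: Koblitz–Ogus class relation, hexagon, twin-or-`γ`) and
part II (`HodgeQuadruplesTwoThreePowerStep`: the vocabulary `IsStdMultiset` / `IsSmallLift`, the unit case, halving, thirding,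
the twin transfer, and the inductive step MODULO the mixed configurations). (The docstrings of parts I, II, V, VII refer to
this material as parts III `HodgeQuadruplesTwoThreePowerMixed` and IV `StandardQuadrupleTwoThreePower` of the working series;
they are merged in this file.)

PART A — NO MIXED QUADRUPLE. A pair-free Hodge `4`-multiset over `ℤ/m` (`m = 2ᵃ3ᵇ`, `a, b ≥ 2`, `m > 144`) none of whose
members is prime to `m` is never MIXED — it cannot contain both an odd member and a member prime to `3` — which is the case
`N = 0` ("`G.C.D.(aᵢ, m) > 1` for all `i`": then `α ∈ 𝔇²ₘ` or `α` is imprimitive) of Aoki's proof of Thm. C ([Aoki1983, §9 (V)],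
there via Thm. D for all `m`); whence the unconditional inductive step `T(m/2) ∧ T(m/3) ⟹ T(m)`
(`no_mixed_twoThreePower`, `std_or_small_of_half_third_twoThreePower`).

METHOD (this formalisation's; the print argues with Aoki's `τ_d` and the structure of `A(m, ℓ)`):
* **`isHodgeMultiset_transfer_prime_pow`** — the transfer `ℓn → n` of [Aoki1983, Prop. 2.2]
  (`FermatCharacter.isHodgeMultiset_transfer_prime`) iterated `e` times: for a Hodge `A + c·B` over `ℤ/ℓᵉN` with `A`
  prime to `ℓ` and `B ⊆ ℓᵉℤ`, `(A mod N) + ℓᵉc·(B/ℓᵉ mod N)` is Hodge at level `N` (`ℓ ∣ N`).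
* **`count_add_half_eq_of_unit_support`** — part I's hexagon for a Hodge multiset `T` of any size whose unit members sit
  at two points `y, y₂` with `#_{−y} T = 0`: then `#_{y + m/2} T = #_y T` (so `y₂` is the twin of `y`).
* A mixed quadruple is `{u₁, u₂, v₁, v₂}`, `uᵢ` odd multiples of `3`, `vᵢ` even and prime to `3` (`mixed_shape`: the
  number of odd members is even). With `3ᵉ ∥ u₁ ∣` minimal and `2ᶠ ∥ v₁` minimal: (M1) `e ≤ b − 2`: `T₃ᵉ(s)` at level
  `m/3ᵉ` has unit members `3ᵉ × {u₁/3ᵉ, u₂/3ᵉ}` only, the hexagon gives the twins `u₂ = u₁ + m/2`, and part II's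
  `twin_transfer` at level `m/2` leaves five alternatives each putting a multiple of `3` among the `vᵢ`; (M2) `f ≤ a − 2`:
  symmetrically `T₂ᶠ(s)` gives `v₂ = v₁ + m/2`, and the zero sum modulo `3` gives `3 ∣ v₁`; (M3) `e ≥ b − 1`, `f ≥ a − 1`:
  `u₁ + u₂ = −(v₁ + v₂) = c` with `n ≤ ⟨c⟩ ≤ 5n` (`n = m/6`), and the units `1 + D·j` (`D = 2ᵃ·3`, resp. `2·3ᵇ` when
  `b = 2`) move one member along a coset of spacing `D < n` across the threshold of the norm equation
  (`norm_shift_contra`) — Shioda's condition `Σ ⟨t aᵢ⟩ = 2m` fails for some unit `t`.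
* **`no_mixed_twoThreePower`**, **`std_or_small_of_half_third_twoThreePower`** (`T(m/2) ∧ T(m/3) ⟹ T(m)` at `m = 2ᵃ3ᵇ`,
  `a, b ≥ 2`, `m > 144`). Part IV runs the induction from the levels `≤ 144` and the side families `2·3ᵇ`, `2ᵃ·3`.


PART B — THE INDUCTION AND `Δ = 0`.

* `StdOrSmall L` (`T(L)`): every pair-free Hodge `4`-multiset over `ℤ/L` is `α_x`, `β_x`, `γ_x` (`IsStdMultiset`) or a lift
  from a level `≤ 72` (`IsSmallLift`). `T(L)` is void for `L ≤ 72`; `T(108)`, `T(144)` come from the kernel-checked table of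
  [MeyerNeutsch1981Fermatquadrupel] up to `180` (`ExceptionalQuadruplesCompleteLeOneHundredEighty`: no rows `108`, `144`; an
  imprimitive quadruple of a level `≤ 144` is a lift from a level `≤ 72`).
* **`stdOrSmall_twoThreePower`**: `T(2ᵃ3ᵇ)` for all `a, b ≥ 2`, by induction on `a + b`, CONDITIONALLY on `T` at the edge
  levels `2·3ᵇ′` and `2ᵃ′·3` (`a′, b′ ≥ 2`) of the tower, where the engine of part I does not apply (at `a = 1` the functional
  `Φ_y` is not `2`-closed, at `b = 1` there is no hexagon) and which enter as `T(m/2)` at `a = 2` resp. `T(m/3)` at `b = 2`.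
  These edge families are NOT treated in this series (open in the tree beyond the kernel sweeps: `2·3ᵇ ≤ 486`, `2ᵃ·3 ≤ 384`
  are covered by `ExceptionalQuadruplesSweep*` / the table, as `Δ = 0` for the primitive quadruples).
* `isStdMultiset_of_isStandardQuadruple`, `isStandardQuadruple_of_isStdMultiset_of_isPrimitive` (`4 ∣ m`, `9 ∣ m`),
  `not_isPrimitive_of_isSmallLift`: the dictionary between the multiset vocabulary of the induction and
  [MeyerNeutsch1981Fermatquadrupel]'s standard / exceptional quadruples (`IsStandardQuadruple`, `IsExceptionalQuadruple`).
* **`not_isExceptionalQuadruple_twoThreePower`** (`Δ(2ᵃ3ᵇ) = 0`, `a, b ≥ 2`, `2ᵃ3ᵇ > 72`, given `T` on the edges) and the letter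
  **`thmB2m_standard_twoThreePower`** of [AokiShioda1983, Thm. (𝔅²ₘ) (ii)] = the body of the named fact
  `HodgeTheory.AokiShioda1983_thmB2m_standard` at these levels (via `letter_of_forall_not_isExceptionalQuadruple`).


The edge families enter as hypotheses `H₁ = T(2·3ᵇ)`, `H₂ = T(2ᵃ·3)`; they are discharged in `StandardQuadrupleTwoThree`
(with parts V `HodgeQuadruplesTwoPowThree` and VII `HodgeQuadruplesTwiceThreePow`), which also assembles the unconditional
statements for all `2ᵃ3ᵇ`.

Cross-checks outside Lean (cell `pub-hfermat`, `pub-hfermat-lit/g39-session/towers/`): `enum_b2.py` — at `m = 144, …, 864`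
no indecomposable Hodge `4`-multiset without a unit member is mixed; `mixed/probe1.py` — at `m = 144, 216, 288, 324` every
candidate `{u₁, u₂, v₁, v₂}` of the mixed shape with zero sum violates Shioda's norm equation at some unit.


HONEST FRAMING (cell `pub-hfermat`): explicit algebraic cycles for specific Hodge classes on Fermat/Delsarte varieties; residual
open instances listed; no claim on general Hodge. (Surface classes are algebraic by Lefschetz (1,1); this file proves
structure statements about Shioda's Hodge condition towards a printed theorem; no cycle is constructed here.)

## References
* [Aoki1983] N. Aoki, *On some arithmetic problems related to the Hodge cycles on the Fermat varieties*, Math. Ann. 266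
  (1983) 23–54 — Thm. C p. 47, §9 (V) pp. 52–54 (`N = 0`), Prop. 2.2 (level change), Thm. D.
* [AokiShioda1983] N. Aoki, T. Shioda, *Generators of the Néron–Severi group of a Fermat surface*, Progr. Math. 35 (1983)
  1–12 — §2 Thm. (𝔅²ₘ) (ii) a), b), c), p. 3.
* [Shioda1982PicardFermat] T. Shioda, *On the Picard number of a Fermat surface*, J. Fac. Sci. Univ. Tokyo IA 28 (1982)
  725–734 — §2 p. 726, table p. 727, Lemma 1 p. 728, Prop. 4 (Q′) p. 729.
* [MeyerNeutsch1981Fermatquadrupel] W. Meyer, W. Neutsch, *Fermatquadrupel*, Math. Ann. 256 (1981) 51–62 — (9)–(10) p. 52,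
  (13)–(15) p. 53, Tabelle 1 p. 54.
* [Deligne1982HodgeCycles] P. Deligne, *Hodge cycles on abelian varieties*, LNM 900 (1982), Rem. 7.16 (a) (Koblitz–Ogus);
  through part I.
* [Shioda1979PJA] T. Shioda, Proc. Japan Acad. 55A (1979) 111–114, §1 (2), (3) (the Hodge condition `IsHodgeMultiset`).
-/

namespace Literature.AlgebraicGeometry.Shioda1982

open Finset Multiset
open Literature.AlgebraicGeometry.HodgeTheory Literature.AlgebraicGeometry.HodgeTheory.FermatCharacter


/-! ### Iterated transfer `ℓᵉN → N` -/

section IteratedTransfer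

variable {ℓ : ℕ}

/-- The reduction `ℤ/m → ℤ/N` on representatives. [folklore] -/
private theorem val_castHom₃ {m N : ℕ} [NeZero m] (hNm : N ∣ m) (y : ZMod m) :
    (ZMod.castHom hNm (ZMod N) y).val = y.val % N := by
  rw [ZMod.castHom_apply, ZMod.cast_eq_val, ZMod.val_natCast]

/-- In `ℤ/L`, `L = 2K`: `2x = 0` forces `x ∈ {0, K}`. [folklore] -/
private theorem eq_zero_or_eq_half₃ {L K : ℕ} [NeZero L] (hL : L = 2 * K) {x : ZMod L} (h : (2 : ZMod L) * x = 0) :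
    x = 0 ∨ x = ((K : ℕ) : ZMod L) := by
  have hx := ZMod.val_lt x
  have hdiv : L ∣ 2 * x.val := by
    rw [← ZMod.natCast_eq_zero_iff, Nat.cast_mul, Nat.cast_ofNat, ZMod.natCast_zmod_val, h]
  obtain ⟨c, hc⟩ := hdiv
  have hc2 : c < 2 := by
    by_contra hc2
    have : 2 * L ≤ L * c := by nlinarith
    omega
  interval_cases c
  · left
    apply ZMod.val_injective L
    rw [ZMod.val_zero]; omega
  · right
    apply ZMod.val_injective L
    rw [ZMod.val_natCast, Nat.mod_eq_of_lt (by omega)]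
    omega

/-- Ring homomorphisms `ℤ/L → ℤ/L` are the identity: `castHom` along `L ∣ L`. [folklore] -/
private theorem castHom_refl_apply {L : ℕ} (h : L ∣ L) (x : ZMod L) : ZMod.castHom h (ZMod L) x = x :=
  RingHom.congr_fun (RingHom.ext_zmod (ZMod.castHom h (ZMod L)) (RingHom.id (ZMod L))) x

/-- Reduction maps between the `ℤ/aℤ` compose. [folklore] -/
private theorem castHom_castHom_apply {a b d : ℕ} (hab : a ∣ b) (hbd : b ∣ d) (had : a ∣ d) (x : ZMod d) :
    ZMod.castHom hab (ZMod a) (ZMod.castHom hbd (ZMod b) x) = ZMod.castHom had (ZMod a) x :=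
  RingHom.congr_fun (RingHom.ext_zmod ((ZMod.castHom hab (ZMod a)).comp (ZMod.castHom hbd (ZMod b)))
    (ZMod.castHom had (ZMod a))) x

/-- Dividing a representative by `ℓᵉ⁺¹` in two steps, through the level `L′ = ℓᵉN`: for `ℓᵉ⁺¹ ∣ X`,
`((X/ℓ) mod L′)/ℓᵉ ≡ X/ℓᵉ⁺¹ (mod N)`. [folklore] -/
private theorem cast_div_mod_div {e N L' X : ℕ} (hℓ : 0 < ℓ) (hL' : L' = ℓ ^ e * N) (hX : ℓ ^ (e + 1) ∣ X) :
    ((((X / ℓ) % L') / ℓ ^ e : ℕ) : ZMod N) = ((X / ℓ ^ (e + 1) : ℕ) : ZMod N) := by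
  set Y := X / ℓ with hY
  have hpos : 0 < ℓ ^ e := by positivity
  have heY : ℓ ^ e ∣ Y := by
    obtain ⟨c, hc⟩ := hX
    refine ⟨c, ?_⟩
    rw [hY, hc, show ℓ ^ (e + 1) * c = ℓ ^ e * c * ℓ by ring, Nat.mul_div_cancel _ hℓ]
  have hdiv : Y % L' = Y - ℓ ^ e * (N * (Y / L')) := by
    rw [Nat.mod_eq_sub_mul_div, hL', mul_assoc]
  have hle : N * (Y / L') ≤ Y / ℓ ^ e := by
    rw [Nat.le_div_iff_mul_le hpos]
    calc N * (Y / L') * ℓ ^ e = L' * (Y / L') := by rw [hL']; ring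
      _ ≤ Y := Nat.mul_div_le Y L'
  rw [hdiv, Nat.sub_mul_div, Nat.cast_sub hle, Nat.cast_mul, ZMod.natCast_self, zero_mul, sub_zero, hY,
    Nat.div_div_eq_div_mul, ← pow_succ']

/-- **Iterated transfer `ℓᵉN → N`** (`ℓ` prime, `ℓ ∣ N`). Let `A + c·B` be a Hodge multiset over `ℤ/L`, `L = ℓᵉN`, where
the members of `A` are prime to `ℓ` and those of `B` are divisible by `ℓᵉ`. Then
`(A mod N) + ℓᵉc·((B/ℓᵉ) mod N)` is a Hodge multiset of level `N`: `e` applications of the transfer `ℓn → n` of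
[Aoki1983, Prop. 2.2] (`FermatCharacter.isHodgeMultiset_transfer_prime`), under which a member prime to `ℓ` is reduced
and a member divisible by `ℓ` is divided by `ℓ` and counted `ℓ` times. (This formalisation's packaging; Aoki's `τ_d`.)
[cite: Aoki1983, Prop. 2.2] [cite: Shioda1979PJA, §1 eq. (2)] -/
theorem isHodgeMultiset_transfer_prime_pow (hℓ : ℓ.Prime) (e : ℕ) :
    ∀ {L : ℕ} [NeZero L] {N : ℕ} [NeZero N] (_hL : L = ℓ ^ e * N) (_hN : ℓ ∣ N) (hNL : N ∣ L)
      (A B : Multiset (ZMod L)) (c : ℕ), (∀ x ∈ A, ¬ ℓ ∣ x.val) → (∀ x ∈ B, ℓ ^ e ∣ x.val) →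
      IsHodgeMultiset (A + c • B) →
      IsHodgeMultiset (A.map (ZMod.castHom hNL (ZMod N)) + (ℓ ^ e * c) • B.map fun x ↦ ((x.val / ℓ ^ e : ℕ) : ZMod N)) := by
  induction e with
  | zero =>
    intro L _ N _ hL hN hNL A B c hA hB hs
    rw [pow_zero, one_mul] at hL
    subst hL
    have e1 : A.map (ZMod.castHom hNL (ZMod L)) = A := by
      conv_rhs => rw [← Multiset.map_id A]
      exact Multiset.map_congr rfl fun x _ ↦ castHom_refl_apply hNL x
    have e2 : (B.map fun x ↦ ((x.val / ℓ ^ 0 : ℕ) : ZMod L)) = B := by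
      conv_rhs => rw [← Multiset.map_id B]
      exact Multiset.map_congr rfl fun x _ ↦ by simp
    rw [e1, e2, pow_zero, one_mul]
    exact hs
  | succ e ih =>
    intro L _ N _ hL hN hNL A B c hA hB hs
    haveI := Fact.mk hℓ
    have hℓ0 := hℓ.pos
    obtain ⟨L', hL'⟩ : ∃ L', L' = ℓ ^ e * N := ⟨_, rfl⟩
    haveI : NeZero L' := ⟨by rw [hL']; exact (Nat.pos_iff_ne_zero.mp (by have := NeZero.pos N; positivity))⟩
    have hLL' : L = ℓ * L' := by rw [hL, hL', pow_succ]; ring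
    subst hLL'
    have hℓL' : ℓ ∣ L' := by rw [hL']; exact dvd_mul_of_dvd_right hN _
    have hL'L : L' ∣ ℓ * L' := dvd_mul_left L' ℓ
    have hNL' : N ∣ L' := ⟨ℓ ^ e, by rw [hL', mul_comm]⟩
    -- one transfer `ℓL′ → L′`
    have h1 := isHodgeMultiset_transfer_prime hℓ hℓL' hL'L (s₁ := A) (s₀ := c • B)
      (fun x hx h0 ↦ hA x hx (Nat.dvd_of_mod_eq_zero h0))
      (fun x hx ↦ by
        obtain ⟨-, hx'⟩ := Multiset.mem_nsmul.mp hx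
        exact Nat.mod_eq_zero_of_dvd (dvd_trans (dvd_pow_self ℓ (Nat.succ_ne_zero e)) (hB x hx')))
      hs
    rw [Multiset.map_nsmul, smul_smul] at h1
    set R₁ := ZMod.castHom hL'L (ZMod L') with hR₁
    set g₁ : ZMod (ℓ * L') → ZMod L' := fun w ↦ R₁ (((w.val / ℓ : ℕ)) : ZMod (ℓ * L')) with hg₁
    -- `e` more transfers `L′ → N`
    have h2 := ih hL' hN hNL' (A.map R₁) (B.map g₁) (ℓ * c)
      (fun x hx ↦ by
        obtain ⟨a, ha, rfl⟩ := Multiset.mem_map.mp hx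
        rw [val_castHom₃ hL'L, Nat.dvd_mod_iff hℓL']
        exact hA a ha)
      (fun x hx ↦ by
        obtain ⟨b, hb, rfl⟩ := Multiset.mem_map.mp hx
        rw [hg₁]
        simp only [map_natCast, ZMod.val_natCast]
        rw [Nat.dvd_mod_iff ⟨N, hL'⟩]
        obtain ⟨q, hq⟩ := hB b hb
        exact ⟨q, by rw [hq, show ℓ ^ (e + 1) * q = ℓ ^ e * q * ℓ by ring, Nat.mul_div_cancel _ hℓ0]⟩)
      h1
    rw [Multiset.map_map, Multiset.map_map] at h2
    have eA : A.map (ZMod.castHom hNL' (ZMod N) ∘ R₁) = A.map (ZMod.castHom hNL (ZMod N)) :=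
      Multiset.map_congr rfl fun x _ ↦ castHom_castHom_apply hNL' hL'L hNL x
    have eB : B.map ((fun x : ZMod L' ↦ ((x.val / ℓ ^ e : ℕ) : ZMod N)) ∘ g₁) =
        B.map fun x ↦ ((x.val / ℓ ^ (e + 1) : ℕ) : ZMod N) := by
      refine Multiset.map_congr rfl fun b hb ↦ ?_
      simp only [Function.comp_apply, hg₁, map_natCast, ZMod.val_natCast]
      exact cast_div_mod_div hℓ0 hL' (hB b hb)
    rw [eA, eB, show ℓ ^ e * (ℓ * c) = ℓ ^ (e + 1) * c by ring] at h2
    exact h2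

end IteratedTransfer

/-! ### The hexagon of part I for a Hodge multiset whose unit members sit at two points -/

section UnitSupport

variable {m n i k : ℕ} [NeZero m]

/-- `𝔫 = n = m/6` as a residue modulo `m = 6n`. -/
local notation "𝔫" => (((n : ℕ)) : ZMod m)

/-- `p ∣ ⟨x⟩` iff `x` reduces to `0` modulo `p` (`p ∣ m`). [folklore] -/
private theorem dvd_val_iff_cast₃ {p : ℕ} (hp : p ∣ m) (x : ZMod m) : p ∣ x.val ↔ ZMod.castHom hp (ZMod p) x = 0 := by
  rw [ZMod.castHom_apply, ZMod.cast_eq_val, ZMod.natCast_eq_zero_iff]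

/-- A divisor `p` of `m` divides `⟨−x⟩` iff it divides `⟨x⟩`. [folklore] -/
private theorem dvd_val_neg_iff₃ {p : ℕ} (hp : p ∣ m) (x : ZMod m) : p ∣ (-x).val ↔ p ∣ x.val := by
  rw [dvd_val_iff_cast₃ hp, dvd_val_iff_cast₃ hp, map_neg, neg_eq_zero]

/-- A divisor `p` of `m` dividing `⟨c⟩` divides `⟨x + c⟩` iff it divides `⟨x⟩`. [folklore] -/
private theorem dvd_val_add_iff₃ {p : ℕ} (hp : p ∣ m) (x : ZMod m) {c : ZMod m} (hc : p ∣ c.val) :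
    p ∣ (x + c).val ↔ p ∣ x.val := by
  rw [dvd_val_iff_cast₃ hp, dvd_val_iff_cast₃ hp, _root_.map_add, ((dvd_val_iff_cast₃ hp c).mp hc), add_zero]

omit [NeZero m] in
/-- `j·n` as a residue: `⟨j·n⟩ = j·n` for `j < 6` (`m = 6n`). [folklore] -/
private theorem val_natCast_mul_n₃ (hm : m = 6 * n) (hn0 : 0 < n) {j : ℕ} (hj : j < 6) :
    (((j : ℕ) : ZMod m) * 𝔫).val = j * n := by
  rw [show ((j : ℕ) : ZMod m) * 𝔫 = ((j * n : ℕ) : ZMod m) by push_cast; ring, ZMod.val_natCast,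
    Nat.mod_eq_of_lt (by rw [hm]; nlinarith)]

omit [NeZero m] in
/-- `p ∣ ⟨j·n⟩` when `p ∣ n` (`p ∣ m`). [folklore] -/
private theorem dvd_val_mul_n₃ {p : ℕ} (hp : p ∣ m) (hpn : p ∣ n) (j : ℕ) : p ∣ (((j : ℕ) : ZMod m) * 𝔫).val := by
  rw [show ((j : ℕ) : ZMod m) * 𝔫 = ((j * n : ℕ) : ZMod m) by push_cast; ring, ZMod.val_natCast]
  exact (Nat.dvd_mod_iff hp).mpr (Dvd.dvd.mul_left hpn j)

/-- **`2y + j·n ≠ 0`** for `y` prime to `3` (`3 ∣ n`, `3 ∣ m`): reduce modulo `3`. [folklore] -/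
private theorem two_mul_add_ne_zero₃ (h3m : 3 ∣ m) (h3 : 3 ∣ n) {y : ZMod m} (hy3 : ¬ 3 ∣ y.val) (j : ℕ) :
    2 * y + ((j : ℕ) : ZMod m) * 𝔫 ≠ 0 := by
  intro h
  set ρ := ZMod.castHom h3m (ZMod 3) with hρ
  have hn3 : ρ (((j : ℕ) : ZMod m) * 𝔫) = 0 := (dvd_val_iff_cast₃ h3m _).mp (dvd_val_mul_n₃ h3m h3 j)
  have hy' : ρ y ≠ 0 := fun e ↦ hy3 ((dvd_val_iff_cast₃ h3m y).mpr e)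
  have e := congrArg ρ h
  rw [_root_.map_add, _root_.map_mul, hn3, add_zero, map_ofNat, _root_.map_zero] at e
  have key : ∀ x : ZMod 3, 2 * x = 0 → x = 0 := by decide
  exact hy' (key _ e)

variable (n) in
/-- The twelve points `±(y + j·n)`, `j = 0, …, 5`, indexed by `Fin 2 × Fin 6` (as in part I). [folklore] -/
private def pt₃ (y : ZMod m) (e : Fin 2 × Fin 6) : ZMod m :=
  if e.1 = 0 then y + ((e.2 : ℕ) : ZMod m) * 𝔫 else -(y + ((e.2 : ℕ) : ZMod m) * 𝔫)

/-- The twelve points `±(y + j·n)` are pairwise distinct (`y` prime to `3`, `3 ∣ n`), as in part I. [folklore] -/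
private theorem pt₃_injective (hm : m = 6 * n) (hn0 : 0 < n) (h3 : 3 ∣ n) {y : ZMod m} (hy3 : ¬ 3 ∣ y.val) :
    Function.Injective (pt₃ n y) := by
  have h3m : 3 ∣ m := ⟨2 * n, by rw [hm]; ring⟩
  rintro ⟨e, j⟩ ⟨e', l⟩ h
  have hj := j.isLt
  have hl := l.isLt
  have same : y + ((j : ℕ) : ZMod m) * 𝔫 = y + ((l : ℕ) : ZMod m) * 𝔫 → j = l := fun e ↦ by
    have hv := congrArg ZMod.val (add_left_cancel e)
    rw [val_natCast_mul_n₃ hm hn0 hj, val_natCast_mul_n₃ hm hn0 hl] at hv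
    exact Fin.ext (Nat.eq_of_mul_eq_mul_right hn0 hv)
  have opp : y + ((j : ℕ) : ZMod m) * 𝔫 ≠ -(y + ((l : ℕ) : ZMod m) * 𝔫) := by
    intro e2
    apply two_mul_add_ne_zero₃ h3m h3 hy3 (j + l)
    push_cast
    linear_combination e2
  have opp' : -(y + ((j : ℕ) : ZMod m) * 𝔫) ≠ y + ((l : ℕ) : ZMod m) * 𝔫 := by
    intro e2
    apply two_mul_add_ne_zero₃ h3m h3 hy3 (l + j)
    push_cast
    linear_combination -e2
  fin_cases e <;> fin_cases e'
  · simp only [pt₃, Fin.zero_eta, Fin.isValue, ↓reduceIte] at h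
    rw [same h]
  · simp only [pt₃, Fin.zero_eta, Fin.isValue, ↓reduceIte, Fin.mk_one, one_ne_zero] at h
    exact absurd h opp
  · simp only [pt₃, Fin.mk_one, Fin.isValue, one_ne_zero, ↓reduceIte, Fin.zero_eta] at h
    exact absurd h opp'
  · simp only [pt₃, Fin.mk_one, Fin.isValue, one_ne_zero, ↓reduceIte, neg_inj] at h
    rw [same h]

/-- The twelve points `±(y + j·n)` are units (odd and prime to `3`) when `y` is and `2, 3 ∣ n`. [folklore] -/
private theorem pt₃_unit (hm : m = 6 * n) (h2 : 2 ∣ n) (h3 : 3 ∣ n) {y : ZMod m} (hy2 : ¬ 2 ∣ y.val)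
    (hy3 : ¬ 3 ∣ y.val) (e : Fin 2 × Fin 6) : ¬ 2 ∣ (pt₃ n y e).val ∧ ¬ 3 ∣ (pt₃ n y e).val := by
  have h2m : 2 ∣ m := ⟨3 * n, by rw [hm]; ring⟩
  have h3m : 3 ∣ m := ⟨2 * n, by rw [hm]; ring⟩
  have a2 : ¬ 2 ∣ (y + ((e.2 : ℕ) : ZMod m) * 𝔫).val := by rwa [dvd_val_add_iff₃ h2m y (dvd_val_mul_n₃ h2m h2 _)]
  have a3 : ¬ 3 ∣ (y + ((e.2 : ℕ) : ZMod m) * 𝔫).val := by rwa [dvd_val_add_iff₃ h3m y (dvd_val_mul_n₃ h3m h3 _)]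
  unfold pt₃
  split_ifs
  · exact ⟨a2, a3⟩
  · exact ⟨by rwa [dvd_val_neg_iff₃ h2m], by rwa [dvd_val_neg_iff₃ h3m]⟩

/-- The arithmetic of the hexagon for multiplicities supported (among the eleven points `≠ y`) at a single point: with
`c e` the multiplicity at the point `e`, the two hexagon identities, `c(0,0) ≥ 1`, `c(1,0) = 0` and "two distinct points
`≠ (0,0)` are not both charged" force `c(0,3) = c(0,0)`. [folklore] -/
private theorem unit_support_arith (c : Fin 2 × Fin 6 → ℕ)
    (hone : ∀ e e' : Fin 2 × Fin 6, e ≠ (0, 0) → e' ≠ (0, 0) → c e ≠ 0 → c e' ≠ 0 → e = e')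
    (E1 : ((c (0, 0) : ℤ) - c (1, 0)) - ((c (0, 3) : ℤ) - c (1, 3)) = ((c (0, 2) : ℤ) - c (1, 2)) - ((c (0, 5) : ℤ) - c (1, 5)))
    (E2 : ((c (0, 2) : ℤ) - c (1, 2)) - ((c (0, 5) : ℤ) - c (1, 5)) = ((c (0, 4) : ℤ) - c (1, 4)) - ((c (0, 1) : ℤ) - c (1, 1)))
    (h0 : 0 < c (0, 0)) (hneg : c (1, 0) = 0) : c (0, 3) = c (0, 0) := by
  -- from one charged point, all the others (≠ (0,0)) are empty
  have oth : ∀ e : Fin 2 × Fin 6, e ≠ (0, 0) → c e ≠ 0 → ∀ e' : Fin 2 × Fin 6, e' ≠ (0, 0) → e' ≠ e → c e' = 0 :=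
    fun e he hce e' he' hne ↦ by
      by_contra h
      exact hne (hone e' e he' he h hce)
  by_cases h03 : c (0, 3) = 0
  · exfalso
    by_cases h13 : c (1, 3) = 0
    · by_cases h02 : c (0, 2) = 0
      · by_cases h15 : c (1, 5) = 0
        · by_cases h12 : c (1, 2) = 0
          · by_cases h05 : c (0, 5) = 0
            · rw [h03, h13, h02, h15, h12, h05, hneg] at E1; push_cast at E1; omega
            · have z := oth (0, 5) (by decide) h05
              have := z (0, 2) (by decide) (by decide); have := z (1, 5) (by decide) (by decide)
              have := z (1, 2) (by decide) (by decide)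
              omega
          · have z := oth (1, 2) (by decide) h12
            have := z (0, 2) (by decide) (by decide); have := z (1, 5) (by decide) (by decide)
            have := z (0, 5) (by decide) (by decide)
            omega
        · have z := oth (1, 5) (by decide) h15
          have := z (0, 2) (by decide) (by decide); have := z (1, 2) (by decide) (by decide)
          have := z (0, 5) (by decide) (by decide); have := z (0, 4) (by decide) (by decide)
          have := z (1, 4) (by decide) (by decide); have := z (0, 1) (by decide) (by decide)
          have := z (1, 1) (by decide) (by decide)
          omega
      · have z := oth (0, 2) (by decide) h02
        have := z (1, 5) (by decide) (by decide); have := z (1, 2) (by decide) (by decide)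
        have := z (0, 5) (by decide) (by decide); have := z (0, 4) (by decide) (by decide)
        have := z (1, 4) (by decide) (by decide); have := z (0, 1) (by decide) (by decide)
        have := z (1, 1) (by decide) (by decide)
        omega
    · have z := oth (1, 3) (by decide) h13
      have := z (0, 2) (by decide) (by decide); have := z (1, 2) (by decide) (by decide)
      have := z (0, 5) (by decide) (by decide); have := z (1, 5) (by decide) (by decide)
      omega
  · have z := oth (0, 3) (by decide) h03
    have := z (1, 3) (by decide) (by decide); have := z (0, 2) (by decide) (by decide)
    have := z (1, 2) (by decide) (by decide); have := z (0, 5) (by decide) (by decide)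
    have := z (1, 5) (by decide) (by decide)
    omega

/-- **The hexagon for a Hodge multiset whose unit members sit at (at most) two points.** Let `m = 6n = 2ᵃ3ᵇ`, `a, b ≥ 2`
(`n = 2ⁱ3ᵏ`, `i, k ≥ 1`), `T` a Hodge multiset over `ℤ/m` (any size), `y` a unit with `#_y T > 0`, `#_{−y} T = 0`, and
suppose every unit `w` with `#_w T ≠ 0` is `y` or a fixed `y₂`. Then **`#_{y + 3n} T = #_y T`** (so `y₂ = y + m/2` is the
twin of `y`, charged equally). PROOF: part I's hexagon identities `o(y) − o(y+3n) = o(y+2n) − o(y+5n) = o(y+4n) − o(y+n)`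
at the twelve distinct unit points `±(y + jn)`, of which at most one besides `y` is charged (`unit_support_arith`). Used in
this file (part A) on the transferred multisets `T₂ᶠ(s)`, `T₃ᵉ(s)` of a mixed quadruple, whose unit members are `2ᶠ` resp. `3ᵉ`
copies of one or two points. This formalisation's lemma towards [Aoki1983, Thm. C] at the levels `2ᵃ3ᵇ`.
[cite: Deligne1982HodgeCycles, Rem. 7.16 (a)] [cite: Aoki1983, Prop. 2.2; Thm. C] -/
theorem count_add_half_eq_of_unit_support (hm : m = 6 * n) (hn : n = 2 ^ i * 3 ^ k) (hi : 1 ≤ i) (hk : 1 ≤ k)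
    {T : Multiset (ZMod m)} (hT : IsHodgeMultiset T) {y y₂ : ZMod m} (hy2 : ¬ 2 ∣ y.val) (hy3 : ¬ 3 ∣ y.val)
    (hsupp : ∀ w : ZMod m, ¬ 2 ∣ w.val → ¬ 3 ∣ w.val → count w T ≠ 0 → w = y ∨ w = y₂)
    (hpos : 0 < count y T) (hneg : count (-y) T = 0) : count (y + 3 * 𝔫) T = count y T := by
  classical
  have hn0 : 0 < n := by rw [hn]; positivity
  obtain ⟨i', rfl⟩ := Nat.exists_eq_add_of_le' hi
  obtain ⟨k', rfl⟩ := Nat.exists_eq_add_of_le' hk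
  have h2 : 2 ∣ n := ⟨2 ^ i' * 3 ^ (k' + 1), by rw [hn]; ring⟩
  have h3 : 3 ∣ n := ⟨2 ^ (i' + 1) * 3 ^ k', by rw [hn]; ring⟩
  obtain ⟨E1, E2⟩ := countSub_hexagon_twoThreePower' hm hn hi hk hT hy2 hy3
  have inj := pt₃_injective hm hn0 h3 hy3
  set c : Fin 2 × Fin 6 → ℕ := fun e ↦ count (pt₃ n y e) T with hc
  -- values of `c` at the named points
  have c00 : c (0, 0) = count y T := by simp [hc, pt₃]
  have c10 : c (1, 0) = count (-y) T := by simp [hc, pt₃]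
  have c01 : c (0, 1) = count (y + 𝔫) T := by simp [hc, pt₃]
  have c11 : c (1, 1) = count (-(y + 𝔫)) T := by simp [hc, pt₃]
  have c02 : c (0, 2) = count (y + 2 * 𝔫) T := by simp [hc, pt₃]
  have c12 : c (1, 2) = count (-(y + 2 * 𝔫)) T := by simp [hc, pt₃]
  have c03 : c (0, 3) = count (y + 3 * 𝔫) T := by simp [hc, pt₃]
  have c13 : c (1, 3) = count (-(y + 3 * 𝔫)) T := by simp [hc, pt₃]
  have c04 : c (0, 4) = count (y + 4 * 𝔫) T := by simp [hc, pt₃]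
  have c14 : c (1, 4) = count (-(y + 4 * 𝔫)) T := by simp [hc, pt₃]
  have c05 : c (0, 5) = count (y + 5 * 𝔫) T := by simp [hc, pt₃]
  have c15 : c (1, 5) = count (-(y + 5 * 𝔫)) T := by simp [hc, pt₃]
  -- two charged points other than `(0,0)` coincide (both are `y₂`)
  have hone : ∀ e e' : Fin 2 × Fin 6, e ≠ (0, 0) → e' ≠ (0, 0) → c e ≠ 0 → c e' ≠ 0 → e = e' := by
    intro e e' he he' hce hce'
    have key : ∀ d : Fin 2 × Fin 6, d ≠ (0, 0) → c d ≠ 0 → pt₃ n y d = y₂ := fun d hd hcd ↦ by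
      obtain ⟨u2, u3⟩ := pt₃_unit hm h2 h3 hy2 hy3 d
      rcases hsupp _ u2 u3 hcd with h | h
      · exact absurd (inj (by rw [h]; simp [pt₃])) hd
      · exact h
    exact inj (by rw [key e he hce, key e' he' hce'])
  rw [← c00, ← c10, ← c03, ← c13, ← c02, ← c12, ← c05, ← c15] at E1
  rw [← c02, ← c12, ← c05, ← c15, ← c04, ← c14, ← c01, ← c11] at E2
  rw [← c03, ← c00]
  exact unit_support_arith c hone E1 E2 (by rw [c00]; exact hpos) (by rw [c10]; exact hneg)

end UnitSupport

/-! ### The mixed configurations: two odd multiples of `3` and two even members prime to `3` -/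

section Mixed

variable {m n i k : ℕ} [NeZero m]

/-- `𝔫 = n = m/6` as a residue modulo `m = 6n`. -/
local notation "𝔫" => (((n : ℕ)) : ZMod m)

/-- The cast of the norm sum is the sum. [folklore] -/
private theorem natCast_mNormSum (t : Multiset (ZMod m)) : ((mNormSum t : ℕ) : ZMod m) = t.sum := by
  induction t using Multiset.induction with
  | empty => simp [mNormSum]
  | cons a u ih => rw [mNormSum_cons, Nat.cast_add, ZMod.natCast_zmod_val, ih, Multiset.sum_cons]

omit [NeZero m] in
/-- A sum of odd representatives has the parity of the number of terms. [folklore] -/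
private theorem mNormSum_mod_two_of_odd {t : Multiset (ZMod m)} (ht : ∀ x ∈ t, ¬ 2 ∣ x.val) :
    mNormSum t % 2 = card t % 2 := by
  induction t using Multiset.induction with
  | empty => simp [mNormSum]
  | cons a u ih =>
    rw [mNormSum_cons, Multiset.card_cons, Nat.add_mod, ih (fun x hx ↦ ht x (Multiset.mem_cons_of_mem hx)),
      Nat.add_mod (card u)]
    have ha : a.val % 2 = 1 := by have := ht a (Multiset.mem_cons_self a u); omega
    rw [ha]
    omega

omit [NeZero m] in
/-- A sum of even representatives is even. [folklore] -/
private theorem two_dvd_mNormSum_of_even {t : Multiset (ZMod m)} (ht : ∀ x ∈ t, 2 ∣ x.val) : 2 ∣ mNormSum t := by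
  unfold mNormSum
  exact Multiset.dvd_sum fun x hx ↦ by
    obtain ⟨a, ha, rfl⟩ := Multiset.mem_map.mp hx
    exact ht a ha

/-- **The shape of a mixed quadruple.** A pair-free Hodge `4`-multiset over `ℤ/m` (`2 ∣ m`, `3 ∣ m`) without a member
prime to `6`, with an odd member and with a member prime to `3`, is `{u₁, u₂, v₁, v₂}` with `u₁, u₂` odd multiples of `3`
and `v₁, v₂` even and prime to `3`: the number of odd members is even (the representatives add up to a multiple of the even
`m`) and is neither `0` nor `4`; the zero sum read modulo `3` makes both even members prime to `3`. This formalisation's lemma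
(used again by the edge family `3·2ᵃ`, `StandardQuadrupleTwoThree`). [cite: Shioda1979PJA, §1 (2), (3)]
[cite: Shioda1982PicardFermat, §2 p. 726] -/
theorem mixed_shape (h2m : 2 ∣ m) (h3m : 3 ∣ m) {s : Multiset (ZMod m)} (hs : IsHodgeMultiset s)
    (hcard : card s = 4) (hnu : ∀ a ∈ s, 2 ∣ a.val ∨ 3 ∣ a.val) (hodd : ∃ a ∈ s, ¬ 2 ∣ a.val)
    (hthree : ∃ a ∈ s, ¬ 3 ∣ a.val) :
    ∃ u₁ u₂ v₁ v₂ : ZMod m, s = u₁ ::ₘ u₂ ::ₘ {v₁, v₂} ∧ (¬ 2 ∣ u₁.val ∧ 3 ∣ u₁.val) ∧ (¬ 2 ∣ u₂.val ∧ 3 ∣ u₂.val) ∧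
      (2 ∣ v₁.val ∧ ¬ 3 ∣ v₁.val) ∧ (2 ∣ v₂.val ∧ ¬ 3 ∣ v₂.val) := by
  classical
  set s₁ := s.filter (fun a ↦ ¬ 2 ∣ a.val) with hs₁
  set s₀ := s.filter (fun a ↦ ¬ ¬ 2 ∣ a.val) with hs₀
  have hsplit : s = s₁ + s₀ := (Multiset.filter_add_not _ s).symm
  have hcards : card s₁ + card s₀ = 4 := by rw [← Multiset.card_add, ← hsplit, hcard]
  have h₁ : ∀ x ∈ s₁, ¬ 2 ∣ x.val := fun x hx ↦ (Multiset.mem_filter.mp hx).2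
  have h₀ : ∀ x ∈ s₀, 2 ∣ x.val := fun x hx ↦ not_not.mp (Multiset.mem_filter.mp hx).2
  -- the number of odd members is even
  have hsum : m ∣ mNormSum s := by
    rw [← ZMod.natCast_eq_zero_iff, natCast_mNormSum, hs.1.2]
  have heven : card s₁ % 2 = 0 := by
    have h := dvd_trans h2m hsum
    rw [hsplit, mNormSum_add] at h
    have h0 := two_dvd_mNormSum_of_even h₀
    have h1 := mNormSum_mod_two_of_odd h₁
    omega
  -- it is `2`
  have hpos : 0 < card s₁ := by
    obtain ⟨a, ha, ha2⟩ := hodd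
    exact Multiset.card_pos_iff_exists_mem.mpr ⟨a, Multiset.mem_filter.mpr ⟨ha, ha2⟩⟩
  have hpos' : 0 < card s₀ := by
    obtain ⟨a, ha, ha3⟩ := hthree
    have ha2 : 2 ∣ a.val := (hnu a ha).resolve_right ha3
    exact Multiset.card_pos_iff_exists_mem.mpr ⟨a, Multiset.mem_filter.mpr ⟨ha, not_not.mpr ha2⟩⟩
  have hc1 : card s₁ = 2 := by omega
  have hc0 : card s₀ = 2 := by omega
  obtain ⟨u₁, u₂, hu⟩ := Multiset.card_eq_two.mp hc1
  obtain ⟨v₁, v₂, hv⟩ := Multiset.card_eq_two.mp hc0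
  have hu₁ : u₁ ∈ s₁ := by rw [hu]; simp
  have hu₂ : u₂ ∈ s₁ := by rw [hu]; simp
  have hv₁ : v₁ ∈ s₀ := by rw [hv]; simp
  have hv₂ : v₂ ∈ s₀ := by rw [hv]; simp
  have hus : ∀ u ∈ s₁, u ∈ s := fun u hu ↦ Multiset.mem_of_mem_filter hu
  have hvs : ∀ v ∈ s₀, v ∈ s := fun v hv ↦ Multiset.mem_of_mem_filter hv
  have hu3 : ∀ u ∈ s₁, 3 ∣ u.val := fun u hu ↦ (hnu u (hus u hu)).resolve_left (h₁ u hu)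
  -- both even members are prime to `3`: zero sum modulo `3`
  set ρ := ZMod.castHom h3m (ZMod 3) with hρ
  have cast3 : ∀ x : ZMod m, 3 ∣ x.val ↔ ρ x = 0 := fun x ↦ by
    rw [ZMod.castHom_apply, ZMod.cast_eq_val, ZMod.natCast_eq_zero_iff]
  have hsum0 := hs.1.2
  rw [hsplit, hu, hv, Multiset.sum_add] at hsum0
  simp only [Multiset.insert_eq_cons, Multiset.sum_cons, Multiset.sum_singleton] at hsum0
  have e3 := congrArg ρ hsum0
  rw [_root_.map_add, _root_.map_add, _root_.map_add, (cast3 u₁).mp (hu3 u₁ hu₁), (cast3 u₂).mp (hu3 u₂ hu₂), zero_add,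
    zero_add, _root_.map_zero] at e3
  have key : ∀ a b : ZMod 3, a + b = 0 → (a = 0 ↔ b = 0) := by decide
  have hv3 : ¬ 3 ∣ v₁.val ∧ ¬ 3 ∣ v₂.val := by
    obtain ⟨a, ha, ha3⟩ := hthree
    have ha0 : a ∈ s₀ := Multiset.mem_filter.mpr ⟨ha, not_not.mpr ((hnu a ha).resolve_right ha3)⟩
    rw [hv] at ha0
    simp only [Multiset.insert_eq_cons, Multiset.mem_cons, Multiset.mem_singleton] at ha0
    rw [cast3, cast3]
    rcases ha0 with rfl | rfl
    · exact ⟨fun h ↦ ha3 ((cast3 _).mpr h), fun h ↦ ha3 ((cast3 _).mpr ((key _ _ e3).mpr h))⟩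
    · exact ⟨fun h ↦ ha3 ((cast3 _).mpr ((key _ _ e3).mp h)), fun h ↦ ha3 ((cast3 _).mpr h)⟩
  refine ⟨u₁, u₂, v₁, v₂, ?_, ⟨h₁ u₁ hu₁, hu3 u₁ hu₁⟩, ⟨h₁ u₂ hu₂, hu3 u₂ hu₂⟩, ⟨h₀ v₁ hv₁, hv3.1⟩, ⟨h₀ v₂ hv₂, hv3.2⟩⟩
  rw [hsplit, hu, hv]
  rfl

omit [NeZero m] in
/-- Dividing representatives by a common divisor `d` of the level: for `d ∣ a`, `m = dN`,
`a/d ≡ c (mod N)` iff `a ≡ dc (mod m)`. [folklore] -/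
private theorem cast_div_eq_iff {d N a c : ℕ} (hd : 0 < d) (hmN : m = d * N) (hda : d ∣ a) :
    ((a / d : ℕ) : ZMod N) = ((c : ℕ) : ZMod N) ↔ ((a : ℕ) : ZMod m) = ((d * c : ℕ) : ZMod m) := by
  obtain ⟨q, rfl⟩ := hda
  rw [Nat.mul_div_cancel_left _ hd, ZMod.natCast_eq_natCast_iff', ZMod.natCast_eq_natCast_iff', hmN,
    Nat.mul_mod_mul_left, Nat.mul_mod_mul_left]
  constructor
  · intro h; rw [h]
  · intro h; exact Nat.eq_of_mul_eq_mul_left hd h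

/-- The representative of a natural-number cast below the level. [folklore] -/
private theorem val_cast_of_lt' {N a : ℕ} [NeZero N] (ha : a < N) : ((a : ℕ) : ZMod N).val = a := by
  rw [ZMod.val_natCast, Nat.mod_eq_of_lt ha]

omit [NeZero m] in
/-- A number `d ≥ 2` dividing `3n = 2ⁱ3ᵏ⁺¹` is divisible by `2` or by `3`. [folklore] -/
private theorem two_or_three_dvd_of_dvd₃ (hn : n = 2 ^ i * 3 ^ k) {d : ℕ} (hd2 : 2 ≤ d) (hdN : d ∣ 3 * n) :
    2 ∣ d ∨ 3 ∣ d := by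
  have hp : d.minFac.Prime := Nat.minFac_prime (by omega)
  have hpd : d.minFac ∣ d := Nat.minFac_dvd d
  have hpN : d.minFac ∣ 2 ^ i * 3 ^ (k + 1) := by
    rw [show 2 ^ i * 3 ^ (k + 1) = 3 * n by rw [hn]; ring]
    exact dvd_trans hpd hdN
  rcases (Nat.Prime.dvd_mul hp).mp hpN with h | h
  · have := (Nat.prime_dvd_prime_iff_eq hp Nat.prime_two).mp (hp.dvd_of_dvd_pow h)
    exact Or.inl (this ▸ hpd)
  · have := (Nat.prime_dvd_prime_iff_eq hp Nat.prime_three).mp (hp.dvd_of_dvd_pow h)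
    exact Or.inr (this ▸ hpd)

/-- **No mixed quadruple, case (M1): the odd members have `3`-adic valuation `e ≤ b − 2`.** Let `m = 6n = 2ᵃ3ᵇ` (`n = 2ⁱ3ᵏ`,
`i, k ≥ 1`, `m > 144`), `T(m/2)` the classification at level `m/2`, and `s = {u₁, u₂, v₁, v₂}` a pair-free Hodge quadruple
with `u₁, u₂` odd multiples of `3`, `v₁, v₂` even and prime to `3`, `3ᵉ ∥ u₁`, `3ᵉ ∣ u₂`, `e ≤ k − 1`. Then: the iterated
transfer `T₃ᵉ(s) = {v̄₁, v̄₂} + 3ᵉ·{u₁/3ᵉ, u₂/3ᵉ}` is Hodge at the level `m/3ᵉ = 2ᵃ3ᵇ⁻ᵉ` (`b − e ≥ 2`), its unit members are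
the `3ᵉ` copies of `u₁/3ᵉ` (and of `u₂/3ᵉ`), so the hexagon of part I forces `u₂/3ᵉ = u₁/3ᵉ + m/(2·3ᵉ)`, i.e. the twins
`u₂ = u₁ + m/2`; then the twin transfer at level `m/2` (part II) leaves five alternatives, each of which puts a multiple of `3`
among `v₁, v₂` or a common odd divisor `≥ 2` into `⟨v₁⟩/2` — impossible. This formalisation's route to [Aoki1983, Thm. C,
§9 (V)] (`N = 0`) at the levels `2ᵃ3ᵇ`. [cite: Aoki1983, Thm. C, §9 (V) pp. 52–54; Prop. 2.2] -/
private theorem mixed_M1 (hm : m = 6 * n) (hn : n = 2 ^ i * 3 ^ k) (hi : 1 ≤ i) (hk : 1 ≤ k) (h144 : 144 < m)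
    (IH₂ : ∀ t : Multiset (ZMod (3 * n)), IsHodgeMultiset t → card t = 4 → ¬ HasPair t →
      IsStdMultiset (3 * n) t ∨ IsSmallLift (3 * n) t)
    {s : Multiset (ZMod m)} (hs : IsHodgeMultiset s) (hpf : ¬ HasPair s) {u₁ u₂ v₁ v₂ : ZMod m}
    (hsx : s = u₁ ::ₘ u₂ ::ₘ {v₁, v₂}) (hu₁ : ¬ 2 ∣ u₁.val ∧ 3 ∣ u₁.val) (hu₂ : ¬ 2 ∣ u₂.val ∧ 3 ∣ u₂.val)
    (hv₁ : 2 ∣ v₁.val ∧ ¬ 3 ∣ v₁.val) (hv₂ : 2 ∣ v₂.val ∧ ¬ 3 ∣ v₂.val) {e : ℕ} (he₁ : 3 ^ e ∣ u₁.val)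
    (he₁' : ¬ 3 ^ (e + 1) ∣ u₁.val) (he₂ : 3 ^ e ∣ u₂.val) (hek : e + 1 ≤ k) : False := by
  classical
  have hn0 : 0 < n := by rw [hn]; positivity
  have h2m : 2 ∣ m := ⟨3 * n, by rw [hm]; ring⟩
  have h3m : 3 ∣ m := ⟨2 * n, by rw [hm]; ring⟩
  have h3e : 0 < 3 ^ e := by positivity
  -- the level `N₃ = m/3ᵉ = 6n₃`
  obtain ⟨k₃, hk₃⟩ := Nat.exists_eq_add_of_le hek
  -- `k = e + 1 + k₃`
  set n₃ := 2 ^ i * 3 ^ (k₃ + 1) with hn₃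
  set N₃ := 6 * n₃ with hN₃
  have hn₃0 : 0 < n₃ := by rw [hn₃]; positivity
  haveI : NeZero N₃ := ⟨by omega⟩
  have hmN : m = 3 ^ e * N₃ := by rw [hm, hn, hk₃, hN₃, hn₃]; ring
  have hN₃m : N₃ ∣ m := ⟨3 ^ e, by rw [hmN, mul_comm]⟩
  have h3N₃ : 3 ∣ N₃ := ⟨2 * n₃, by rw [hN₃]; ring⟩
  have h2N₃ : 2 ∣ N₃ := ⟨3 * n₃, by rw [hN₃]; ring⟩
  -- the iterated transfer `T₃ᵉ(s)`
  have hs' : IsHodgeMultiset ((v₁ ::ₘ {v₂}) + 1 • (u₁ ::ₘ {u₂})) := by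
    rw [one_nsmul, add_comm, show (u₁ ::ₘ {u₂} : Multiset (ZMod m)) + (v₁ ::ₘ {v₂}) = s by rw [hsx]; rfl]
    exact hs
  have hT := isHodgeMultiset_transfer_prime_pow Nat.prime_three e hmN h3N₃ hN₃m (v₁ ::ₘ {v₂}) (u₁ ::ₘ {u₂}) 1
    (by intro x hx; simp only [Multiset.mem_cons, Multiset.mem_singleton] at hx
        rcases hx with rfl | rfl
        · exact hv₁.2
        · exact hv₂.2)
    (by intro x hx; simp only [Multiset.mem_cons, Multiset.mem_singleton] at hx
        rcases hx with rfl | rfl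
        · exact he₁
        · exact he₂)
    hs'
  rw [mul_one] at hT
  simp only [Multiset.map_cons, Multiset.map_singleton] at hT
  set R := ZMod.castHom hN₃m (ZMod N₃) with hR
  set w₁ : ZMod N₃ := ((u₁.val / 3 ^ e : ℕ) : ZMod N₃) with hw₁
  set w₂ : ZMod N₃ := ((u₂.val / 3 ^ e : ℕ) : ZMod N₃) with hw₂
  set T := (R v₁ ::ₘ {R v₂}) + 3 ^ e • (w₁ ::ₘ {w₂}) with hTdef
  -- `w₁` is a unit at level `N₃`
  obtain ⟨q₁, hq₁⟩ := he₁
  have hq₁3 : ¬ 3 ∣ q₁ := fun h ↦ he₁' (by rw [hq₁, pow_succ]; exact Nat.mul_dvd_mul_left _ h)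
  have hq₁2 : ¬ 2 ∣ q₁ := fun h ↦ hu₁.1 (by rw [hq₁]; exact Dvd.dvd.mul_left h _)
  have hw₁val : w₁.val = q₁ % N₃ := by rw [hw₁, hq₁, Nat.mul_div_cancel_left _ h3e, ZMod.val_natCast]
  have hw₁2 : ¬ 2 ∣ w₁.val := by rwa [hw₁val, Nat.dvd_mod_iff h2N₃]
  have hw₁3 : ¬ 3 ∣ w₁.val := by rwa [hw₁val, Nat.dvd_mod_iff h3N₃]
  -- parities at level `N₃`
  have hRv : ∀ v : ZMod m, 2 ∣ v.val → 2 ∣ (R v).val := fun v hv ↦ by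
    rw [hR, val_castHom₃ hN₃m, Nat.dvd_mod_iff h2N₃]; exact hv
  have hw₂odd : ¬ 2 ∣ w₂.val := by
    obtain ⟨q₂, hq₂⟩ := he₂
    have hq₂2 : ¬ 2 ∣ q₂ := fun h ↦ hu₂.1 (by rw [hq₂]; exact Dvd.dvd.mul_left h _)
    rwa [hw₂, hq₂, Nat.mul_div_cancel_left _ h3e, ZMod.val_natCast, Nat.dvd_mod_iff h2N₃]
  -- counts in `T`
  have cntA : ∀ w : ZMod N₃, ¬ 2 ∣ w.val → count w (R v₁ ::ₘ {R v₂}) = 0 := fun w hw ↦ by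
    rw [Multiset.count_eq_zero]
    simp only [Multiset.mem_cons, Multiset.mem_singleton, not_or]
    exact ⟨fun h ↦ hw (h ▸ hRv v₁ hv₁.1), fun h ↦ hw (h ▸ hRv v₂ hv₂.1)⟩
  have cntT : ∀ w : ZMod N₃, ¬ 2 ∣ w.val → count w T = 3 ^ e * count w (w₁ ::ₘ {w₂}) := fun w hw ↦ by
    rw [hTdef, Multiset.count_add, Multiset.count_nsmul, cntA w hw, zero_add]
  have hsupp : ∀ w : ZMod N₃, ¬ 2 ∣ w.val → ¬ 3 ∣ w.val → count w T ≠ 0 → w = w₁ ∨ w = w₂ := by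
    intro w hw2 _ hc
    rw [cntT w hw2] at hc
    have : count w (w₁ ::ₘ {w₂}) ≠ 0 := fun h ↦ hc (by rw [h, mul_zero])
    have hmem := Multiset.count_ne_zero.mp this
    simp only [Multiset.mem_cons, Multiset.mem_singleton] at hmem
    exact hmem
  have hpos : 0 < count w₁ T := by
    rw [cntT w₁ hw₁2, Multiset.count_cons_self]
    positivity
  -- `−w₁` is not charged: `w₂ = −w₁` would make `u₁ + u₂ = 0`
  have hu12 : u₁ + u₂ ≠ 0 := by
    intro h
    apply hpf
    refine ⟨u₁, by rw [hsx]; exact Multiset.mem_cons_self _ _, ?_⟩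
    rw [hsx, Multiset.erase_cons_head, show -u₁ = u₂ by linear_combination -h]
    exact Multiset.mem_cons_self _ _
  have hneg : count (-w₁) T = 0 := by
    have hnw2 : ¬ 2 ∣ (-w₁).val := by
      rw [ZMod.neg_val]
      split_ifs with h0
      · exact absurd (by rw [h0, ZMod.val_zero]; exact dvd_zero 2) hw₁2
      · have := ZMod.val_lt w₁
        obtain ⟨c, hc⟩ := h2N₃
        omega
    rw [cntT _ hnw2, Multiset.count_eq_zero_of_notMem, mul_zero]
    simp only [Multiset.mem_cons, Multiset.mem_singleton, not_or]
    constructor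
    · -- `−w₁ = w₁`: `2w₁ = 0`, impossible for a unit
      intro h
      have h2 : (2 : ZMod N₃) * w₁ = 0 := by linear_combination -h
      rcases eq_zero_or_eq_half₃ (show N₃ = 2 * (3 * n₃) by rw [hN₃]; ring) h2 with h0 | h0
      · exact hw₁2 (by rw [h0, ZMod.val_zero]; exact dvd_zero 2)
      · exact hw₁3 (by rw [h0, ZMod.val_natCast, Nat.mod_eq_of_lt (by omega)]; exact dvd_mul_right 3 n₃)
    · -- `−w₁ = w₂`: then `u₁ + u₂ = 0`
      intro h
      apply hu12
      have hsum : w₁ + w₂ = 0 := by rw [← h]; ring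
      obtain ⟨q₂, hq₂⟩ := he₂
      have e1 : w₁ + w₂ = (((u₁.val + u₂.val) / 3 ^ e : ℕ) : ZMod N₃) := by
        rw [hw₁, hw₂, hq₁, hq₂, ← Nat.cast_add, ← mul_add, Nat.mul_div_cancel_left _ h3e,
          Nat.mul_div_cancel_left _ h3e, Nat.mul_div_cancel_left _ h3e]
      rw [e1, show (0 : ZMod N₃) = ((0 : ℕ) : ZMod N₃) by simp,
        cast_div_eq_iff h3e hmN (by rw [hq₁, hq₂, ← mul_add]; exact dvd_mul_right _ _)] at hsum
      simpa [ZMod.natCast_zmod_val] using hsum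
  -- the hexagon at level `N₃`: `w₁ + N₃/2` is charged like `w₁`
  have key := count_add_half_eq_of_unit_support (m := N₃) (n := n₃) (i := i) (k := k₃ + 1) hN₃ hn₃ hi (by omega) hT
    hw₁2 hw₁3 hsupp hpos hneg
  -- so `w₂ = w₁ + N₃/2`, i.e. `u₂ = u₁ + m/2`
  set H₃ : ZMod N₃ := 3 * ((n₃ : ℕ) : ZMod N₃) with hH₃
  have hH₃val : H₃.val = 3 * n₃ := by
    rw [hH₃, show (3 : ZMod N₃) * ((n₃ : ℕ) : ZMod N₃) = ((3 * n₃ : ℕ) : ZMod N₃) by push_cast; ring,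
      ZMod.val_natCast, Nat.mod_eq_of_lt (by omega)]
  have hodd' : ¬ 2 ∣ (w₁ + H₃).val := by
    rw [ZMod.val_add, Nat.dvd_mod_iff h2N₃, hH₃val, hw₁val]
    intro h
    apply hw₁2
    rw [hw₁val]
    have : 2 ∣ 3 * n₃ := by rw [hn₃]; obtain ⟨i', rfl⟩ := Nat.exists_eq_add_of_le' hi; exact ⟨3 * 2 ^ i' * 3 ^ (k₃ + 1), by ring⟩
    exact (Nat.dvd_add_right this).mp (by rwa [add_comm] at h)
  have hthree' : ¬ 3 ∣ (w₁ + H₃).val := by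
    rw [ZMod.val_add, Nat.dvd_mod_iff h3N₃, hH₃val]
    intro h
    exact hw₁3 ((Nat.dvd_add_left (dvd_mul_right 3 n₃)).mp h)
  have hcharged : count (w₁ + H₃) T ≠ 0 := by rw [key]; exact hpos.ne'
  have hw₂eq : w₂ = w₁ + H₃ := by
    rcases hsupp _ hodd' hthree' hcharged with h | h
    · exfalso
      have : H₃ = 0 := by linear_combination h
      have := congrArg ZMod.val this
      rw [hH₃val, ZMod.val_zero] at this
      omega
    · exact h.symm
  have hu₂eq : u₂ = u₁ + (((3 * n : ℕ)) : ZMod m) := by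
    have e1 : w₂ = (((u₁.val / 3 ^ e + 3 * n₃ : ℕ)) : ZMod N₃) := by
      rw [hw₂eq, hw₁, hH₃]; push_cast; ring
    rw [hw₂, cast_div_eq_iff h3e hmN he₂, ZMod.natCast_zmod_val] at e1
    rw [e1, hq₁, Nat.mul_div_cancel_left _ h3e, show 3 ^ e * (q₁ + 3 * n₃) = 3 ^ e * q₁ + 3 * n by
      rw [hn, hk₃, hn₃]; ring, Nat.cast_add, ← hq₁, ZMod.natCast_zmod_val]
  -- the twin transfer at level `m/2 = 3n`
  haveI : NeZero (3 * n) := ⟨by omega⟩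
  have hmN' : m = 2 * (3 * n) := by rw [hm]; ring
  obtain ⟨i', hi'⟩ := Nat.exists_eq_add_of_le' hi
  obtain ⟨k', hk'⟩ := Nat.exists_eq_add_of_le' hk
  have h2N : 2 ∣ 3 * n := ⟨3 * 2 ^ i' * 3 ^ (k' + 1), by rw [hn, hi', hk']; ring⟩
  have h9N : 9 ∣ 3 * n := ⟨2 ^ (i' + 1) * 3 ^ k', by rw [hn, hi', hk']; ring⟩
  have h72 : 72 < 3 * n := by omega
  have hsx' : s = u₁ ::ₘ (u₁ + (((3 * n : ℕ)) : ZMod m)) ::ₘ {v₁, v₂} := by rw [hsx, hu₂eq]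
  -- reductions modulo `3`
  set ρ := ZMod.castHom h3m (ZMod 3) with hρ
  have cast3 : ∀ x : ZMod m, 3 ∣ x.val ↔ ρ x = 0 := fun x ↦ by
    rw [ZMod.castHom_apply, ZMod.cast_eq_val, ZMod.natCast_eq_zero_iff]
  have ρu : ρ u₁ = 0 := (cast3 u₁).mp hu₁.2
  have ρn3 : ρ (((3 * n : ℕ)) : ZMod m) = 0 := by
    rw [map_natCast, ZMod.natCast_eq_zero_iff]; exact ⟨n, rfl⟩
  have ρR : ρ (((m / 3 : ℕ)) : ZMod m) = 0 := by
    rw [map_natCast, ZMod.natCast_eq_zero_iff, hm, show 6 * n / 3 = 2 * n by omega, hn, hk']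
    exact ⟨2 * 2 ^ i * 3 ^ k', by ring⟩
  have ρv₁ : ρ v₁ ≠ 0 := fun h ↦ hv₁.2 ((cast3 v₁).mpr h)
  rcases twin_transfer hmN' h2N (dvd_trans ⟨3, by norm_num⟩ h9N) (Or.inr h9N) h72 IH₂ hs hpf hsx' (by have := hu₁.1; omega)
      (Nat.mod_eq_zero_of_dvd hv₁.1) (Nat.mod_eq_zero_of_dvd hv₂.1) with hA | hB | ⟨x', hx'⟩ | ⟨-, hv3, -⟩ | ⟨d, hd2, hdN, hdu, hdv, -⟩
  · -- `{v₁, v₂} = {−2u₁, 3n}`: a multiple of `3` among the `v`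
    have mem : v₁ ∈ ((-(2 * u₁)) ::ₘ ({(((3 * n : ℕ)) : ZMod m)} : Multiset (ZMod m))) := by rw [← hA]; simp
    simp only [Multiset.mem_cons, Multiset.mem_singleton] at mem
    rcases mem with h | h
    · apply ρv₁; rw [h, _root_.map_neg, _root_.map_mul, ρu, mul_zero, neg_zero]
    · apply ρv₁; rw [h, ρn3]
  · -- `{v₁, v₂} = {2u₁ + 3n, −4u₁}`
    have mem : v₁ ∈ ((2 * u₁ + (((3 * n : ℕ)) : ZMod m)) ::ₘ ({-(4 * u₁)} : Multiset (ZMod m))) := by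
      rw [← hB]; simp
    simp only [Multiset.mem_cons, Multiset.mem_singleton] at mem
    rcases mem with h | h
    · apply ρv₁; rw [h, _root_.map_add, _root_.map_mul, ρu, ρn3, mul_zero, zero_add]
    · apply ρv₁; rw [h, _root_.map_neg, _root_.map_mul, ρu, mul_zero, neg_zero]
  · -- `{2u₁, v₁, v₂}` a coset of `(m/3)ℤ`: all `≡ 2u₁ ≡ 0 (mod 3)`
    set R' : ZMod m := (((m / 3 : ℕ)) : ZMod m) with hR'
    have memv : v₁ ∈ (x' ::ₘ (x' + R') ::ₘ ({x' + 2 * R'} : Multiset (ZMod m))) := by rw [← hx']; simp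
    have memu : 2 * u₁ ∈ (x' ::ₘ (x' + R') ::ₘ ({x' + 2 * R'} : Multiset (ZMod m))) := by rw [← hx']; simp
    simp only [Multiset.mem_cons, Multiset.mem_singleton] at memv memu
    have ρ2u : ρ (2 * u₁) = 0 := by rw [_root_.map_mul, ρu, mul_zero]
    have ρx : ρ x' = 0 := by
      rcases memu with h | h | h
      · rw [← h]; exact ρ2u
      · have := congrArg ρ h
        rw [ρ2u, _root_.map_add, ρR, add_zero] at this
        exact this.symm
      · have := congrArg ρ h
        rw [ρ2u, _root_.map_add, _root_.map_mul, ρR, mul_zero, add_zero] at this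
        exact this.symm
    apply ρv₁
    rcases memv with h | h | h
    · rw [h, ρx]
    · rw [h, _root_.map_add, ρx, ρR, add_zero]
    · rw [h, _root_.map_add, _root_.map_mul, ρx, ρR, mul_zero, add_zero]
  · exact hv₁.2 hv3
  · -- a common divisor `d ≥ 2` of `3n`, `⟨u₁⟩` (odd) and `⟨v₁⟩/2` (prime to `3`)
    rcases two_or_three_dvd_of_dvd₃ hn hd2 hdN with h | h
    · exact hu₁.1 (dvd_trans h hdu)
    · apply hv₁.2
      have ev : v₁.val = 2 * (v₁.val / 2) := by obtain ⟨c, hc⟩ := hv₁.1; omega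
      rw [ev]
      exact dvd_mul_of_dvd_right (dvd_trans h hdv) 2


omit [NeZero m] in
/-- In `y ::ₘ y' ::ₘ z ::ₘ {w}`, erasing `z` leaves `w`. [folklore] -/
private theorem mem_erase_quad₃ (y y' z w : ZMod m) : w ∈ (y ::ₘ y' ::ₘ z ::ₘ ({w} : Multiset (ZMod m))).erase z := by
  classical
  rw [Multiset.cons_swap y' z, Multiset.cons_swap y z, Multiset.erase_cons_head]
  simp

/-- **No mixed quadruple, case (M2): the even members have `2`-adic valuation `f ≤ a − 2`.** With the notation of (M1),
if `2ᶠ ∥ v₁`, `2ᶠ ∣ v₂`, `f ≤ i − 1`: the iterated transfer `T₂ᶠ(s) = {ū₁, ū₂} + 2ᶠ·{v₁/2ᶠ, v₂/2ᶠ}` is Hodge at the level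
`m/2ᶠ = 2ᵃ⁻ᶠ3ᵇ` (`a − f ≥ 2`), its unit members are the `2ᶠ` copies of `v₁/2ᶠ` (and of `v₂/2ᶠ`), so the hexagon of part I
forces the twins `v₂ = v₁ + m/2`; then the zero sum `u₁ + u₂ + 2v₁ + m/2 = 0` read modulo `3` gives `3 ∣ v₁` — impossible.
This formalisation's route to [Aoki1983, Thm. C, §9 (V)] at the levels `2ᵃ3ᵇ`. [cite: Aoki1983, Thm. C, §9 (V); Prop. 2.2] -/
private theorem mixed_M2 (hm : m = 6 * n) (hn : n = 2 ^ i * 3 ^ k) (hk : 1 ≤ k)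
    {s : Multiset (ZMod m)} (hs : IsHodgeMultiset s) (hpf : ¬ HasPair s) {u₁ u₂ v₁ v₂ : ZMod m}
    (hsx : s = u₁ ::ₘ u₂ ::ₘ {v₁, v₂}) (hu₁ : ¬ 2 ∣ u₁.val ∧ 3 ∣ u₁.val) (hu₂ : ¬ 2 ∣ u₂.val ∧ 3 ∣ u₂.val)
    (hv₁ : 2 ∣ v₁.val ∧ ¬ 3 ∣ v₁.val) (hv₂ : 2 ∣ v₂.val ∧ ¬ 3 ∣ v₂.val) {f : ℕ} (hf₁ : 2 ^ f ∣ v₁.val)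
    (hf₁' : ¬ 2 ^ (f + 1) ∣ v₁.val) (hf₂ : 2 ^ f ∣ v₂.val) (hfi : f + 1 ≤ i) : False := by
  classical
  have hn0 : 0 < n := by rw [hn]; positivity
  have h3m : 3 ∣ m := ⟨2 * n, by rw [hm]; ring⟩
  have h2f : 0 < 2 ^ f := by positivity
  -- the level `N₂ = m/2ᶠ = 6n₂`
  obtain ⟨i₂, hi₂⟩ := Nat.exists_eq_add_of_le hfi
  set n₂ := 2 ^ (i₂ + 1) * 3 ^ k with hn₂
  set N₂ := 6 * n₂ with hN₂
  have hn₂0 : 0 < n₂ := by rw [hn₂]; positivity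
  haveI : NeZero N₂ := ⟨by omega⟩
  have hmN : m = 2 ^ f * N₂ := by rw [hm, hn, hi₂, hN₂, hn₂]; ring
  have hN₂m : N₂ ∣ m := ⟨2 ^ f, by rw [hmN, mul_comm]⟩
  have h2N₂ : 2 ∣ N₂ := ⟨3 * n₂, by rw [hN₂]; ring⟩
  have h3N₂ : 3 ∣ N₂ := ⟨2 * n₂, by rw [hN₂]; ring⟩
  -- the iterated transfer `T₂ᶠ(s)`
  have hs' : IsHodgeMultiset ((u₁ ::ₘ {u₂}) + 1 • (v₁ ::ₘ {v₂})) := by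
    rw [one_nsmul, show (u₁ ::ₘ {u₂} : Multiset (ZMod m)) + (v₁ ::ₘ {v₂}) = s by rw [hsx]; rfl]
    exact hs
  have hT := isHodgeMultiset_transfer_prime_pow Nat.prime_two f hmN h2N₂ hN₂m (u₁ ::ₘ {u₂}) (v₁ ::ₘ {v₂}) 1
    (by intro x hx; simp only [Multiset.mem_cons, Multiset.mem_singleton] at hx
        rcases hx with rfl | rfl
        · exact hu₁.1
        · exact hu₂.1)
    (by intro x hx; simp only [Multiset.mem_cons, Multiset.mem_singleton] at hx
        rcases hx with rfl | rfl
        · exact hf₁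
        · exact hf₂)
    hs'
  rw [mul_one] at hT
  simp only [Multiset.map_cons, Multiset.map_singleton] at hT
  set R := ZMod.castHom hN₂m (ZMod N₂) with hR
  set w₁ : ZMod N₂ := ((v₁.val / 2 ^ f : ℕ) : ZMod N₂) with hw₁
  set w₂ : ZMod N₂ := ((v₂.val / 2 ^ f : ℕ) : ZMod N₂) with hw₂
  set T := (R u₁ ::ₘ {R u₂}) + 2 ^ f • (w₁ ::ₘ {w₂}) with hTdef
  -- `w₁` is a unit at level `N₂`
  obtain ⟨q₁, hq₁⟩ := hf₁
  have hq₁2 : ¬ 2 ∣ q₁ := fun h ↦ hf₁' (by rw [hq₁, pow_succ]; exact Nat.mul_dvd_mul_left _ h)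
  have hq₁3 : ¬ 3 ∣ q₁ := fun h ↦ hv₁.2 (by rw [hq₁]; exact Dvd.dvd.mul_left h _)
  have hw₁val : w₁.val = q₁ % N₂ := by rw [hw₁, hq₁, Nat.mul_div_cancel_left _ h2f, ZMod.val_natCast]
  have hw₁2 : ¬ 2 ∣ w₁.val := by rwa [hw₁val, Nat.dvd_mod_iff h2N₂]
  have hw₁3 : ¬ 3 ∣ w₁.val := by rwa [hw₁val, Nat.dvd_mod_iff h3N₂]
  -- the reduced `u` are divisible by `3`
  have hRu : ∀ u : ZMod m, 3 ∣ u.val → 3 ∣ (R u).val := fun u hu ↦ by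
    rw [hR, val_castHom₃ hN₂m, Nat.dvd_mod_iff h3N₂]; exact hu
  -- counts in `T`
  have cntA : ∀ w : ZMod N₂, ¬ 3 ∣ w.val → count w (R u₁ ::ₘ {R u₂}) = 0 := fun w hw ↦ by
    rw [Multiset.count_eq_zero]
    simp only [Multiset.mem_cons, Multiset.mem_singleton, not_or]
    exact ⟨fun h ↦ hw (h ▸ hRu u₁ hu₁.2), fun h ↦ hw (h ▸ hRu u₂ hu₂.2)⟩
  have cntT : ∀ w : ZMod N₂, ¬ 3 ∣ w.val → count w T = 2 ^ f * count w (w₁ ::ₘ {w₂}) := fun w hw ↦ by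
    rw [hTdef, Multiset.count_add, Multiset.count_nsmul, cntA w hw, zero_add]
  have hsupp : ∀ w : ZMod N₂, ¬ 2 ∣ w.val → ¬ 3 ∣ w.val → count w T ≠ 0 → w = w₁ ∨ w = w₂ := by
    intro w _ hw3 hc
    rw [cntT w hw3] at hc
    have : count w (w₁ ::ₘ {w₂}) ≠ 0 := fun h ↦ hc (by rw [h, mul_zero])
    have hmem := Multiset.count_ne_zero.mp this
    simp only [Multiset.mem_cons, Multiset.mem_singleton] at hmem
    exact hmem
  have hpos : 0 < count w₁ T := by
    rw [cntT w₁ hw₁3, Multiset.count_cons_self]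
    positivity
  -- `−w₁` is not charged: `w₂ = −w₁` would make `v₁ + v₂ = 0`
  have hv12 : v₁ + v₂ ≠ 0 := by
    intro h
    apply hpf
    refine ⟨v₁, by rw [hsx]; simp, ?_⟩
    rw [show -v₁ = v₂ by linear_combination -h, hsx]
    exact mem_erase_quad₃ _ _ _ _
  have cast3 : ∀ x : ZMod N₂, 3 ∣ x.val ↔ ZMod.castHom h3N₂ (ZMod 3) x = 0 := fun x ↦ by
    rw [ZMod.castHom_apply, ZMod.cast_eq_val, ZMod.natCast_eq_zero_iff]
  have hneg : count (-w₁) T = 0 := by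
    have hnw3 : ¬ 3 ∣ (-w₁).val := by rw [cast3, map_neg, neg_eq_zero, ← cast3]; exact hw₁3
    rw [cntT _ hnw3, Multiset.count_eq_zero_of_notMem, mul_zero]
    simp only [Multiset.mem_cons, Multiset.mem_singleton, not_or]
    constructor
    · intro h
      have h2 : (2 : ZMod N₂) * w₁ = 0 := by linear_combination -h
      rcases eq_zero_or_eq_half₃ (show N₂ = 2 * (3 * n₂) by rw [hN₂]; ring) h2 with h0 | h0
      · exact hw₁2 (by rw [h0, ZMod.val_zero]; exact dvd_zero 2)
      · exact hw₁3 (by rw [h0, ZMod.val_natCast, Nat.mod_eq_of_lt (by omega)]; exact dvd_mul_right 3 n₂)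
    · intro h
      apply hv12
      have hsum : w₁ + w₂ = 0 := by rw [← h]; ring
      obtain ⟨q₂, hq₂⟩ := hf₂
      have e1 : w₁ + w₂ = (((v₁.val + v₂.val) / 2 ^ f : ℕ) : ZMod N₂) := by
        rw [hw₁, hw₂, hq₁, hq₂, ← Nat.cast_add, ← mul_add, Nat.mul_div_cancel_left _ h2f,
          Nat.mul_div_cancel_left _ h2f, Nat.mul_div_cancel_left _ h2f]
      rw [e1, show (0 : ZMod N₂) = ((0 : ℕ) : ZMod N₂) by simp,
        cast_div_eq_iff h2f hmN (by rw [hq₁, hq₂, ← mul_add]; exact dvd_mul_right _ _)] at hsum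
      simpa [ZMod.natCast_zmod_val] using hsum
  -- the hexagon at level `N₂`
  have key := count_add_half_eq_of_unit_support (m := N₂) (n := n₂) (i := i₂ + 1) (k := k) hN₂ hn₂ (by omega) hk hT
    hw₁2 hw₁3 hsupp hpos hneg
  set H₂ : ZMod N₂ := 3 * ((n₂ : ℕ) : ZMod N₂) with hH₂
  have hH₂val : H₂.val = 3 * n₂ := by
    rw [hH₂, show (3 : ZMod N₂) * ((n₂ : ℕ) : ZMod N₂) = ((3 * n₂ : ℕ) : ZMod N₂) by push_cast; ring,
      ZMod.val_natCast, Nat.mod_eq_of_lt (by omega)]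
  have h2H : 2 ∣ 3 * n₂ := ⟨3 * 2 ^ i₂ * 3 ^ k, by rw [hn₂]; ring⟩
  have hodd' : ¬ 2 ∣ (w₁ + H₂).val := by
    rw [ZMod.val_add, Nat.dvd_mod_iff h2N₂, hH₂val]
    exact fun h ↦ hw₁2 ((Nat.dvd_add_left h2H).mp h)
  have hthree' : ¬ 3 ∣ (w₁ + H₂).val := by
    rw [ZMod.val_add, Nat.dvd_mod_iff h3N₂, hH₂val]
    exact fun h ↦ hw₁3 ((Nat.dvd_add_left (dvd_mul_right 3 n₂)).mp h)
  have hcharged : count (w₁ + H₂) T ≠ 0 := by rw [key]; exact hpos.ne'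
  have hw₂eq : w₂ = w₁ + H₂ := by
    rcases hsupp _ hodd' hthree' hcharged with h | h
    · exfalso
      have : H₂ = 0 := by linear_combination h
      have := congrArg ZMod.val this
      rw [hH₂val, ZMod.val_zero] at this
      omega
    · exact h.symm
  -- so `v₂ = v₁ + m/2`, and the zero sum modulo `3` makes `3 ∣ v₁`
  have hv₂eq : v₂ = v₁ + (((3 * n : ℕ)) : ZMod m) := by
    have e1 : w₂ = (((v₁.val / 2 ^ f + 3 * n₂ : ℕ)) : ZMod N₂) := by
      rw [hw₂eq, hw₁, hH₂]; push_cast; ring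
    rw [hw₂, cast_div_eq_iff h2f hmN hf₂, ZMod.natCast_zmod_val] at e1
    rw [e1, hq₁, Nat.mul_div_cancel_left _ h2f, show 2 ^ f * (q₁ + 3 * n₂) = 2 ^ f * q₁ + 3 * n by
      rw [hn, hi₂, hn₂]; ring, Nat.cast_add, ← hq₁, ZMod.natCast_zmod_val]
  set ρ := ZMod.castHom h3m (ZMod 3) with hρ
  have cast3m : ∀ x : ZMod m, 3 ∣ x.val ↔ ρ x = 0 := fun x ↦ by
    rw [ZMod.castHom_apply, ZMod.cast_eq_val, ZMod.natCast_eq_zero_iff]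
  have hsum0 := hs.1.2
  rw [hsx, hv₂eq] at hsum0
  simp only [Multiset.insert_eq_cons, Multiset.sum_cons, Multiset.sum_singleton] at hsum0
  have e3 := congrArg ρ hsum0
  rw [_root_.map_add, _root_.map_add, _root_.map_add, _root_.map_add, (cast3m u₁).mp hu₁.2, (cast3m u₂).mp hu₂.2,
    map_natCast, show (((3 * n : ℕ)) : ZMod 3) = 0 by rw [ZMod.natCast_eq_zero_iff]; exact ⟨n, rfl⟩, _root_.map_zero]
    at e3
  have key3 : ∀ a : ZMod 3, 0 + (0 + (a + (a + 0))) = 0 → a = 0 := by decide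
  exact hv₁.2 ((cast3m v₁).mpr (key3 _ e3))

/-! ### Case (M3): both valuations at the top — an explicit family of units -/

/-- **Shifting one member along a coset.** If for every `s` the two representatives `⟨x + Ds⟩`, `⟨−(x + Ds) − c⟩` have the
same sum `K`, where `D ∣ m` and `D < ⟨c⟩ ≤ m − D`, we reach a contradiction: at the smallest point `r < D` of the coset
`x + Dℤ` the sum is `m − ⟨c⟩`, at its largest point `r + m − D` it is `2m − ⟨c⟩`. [folklore] -/
private theorem norm_shift_contra {D : ℕ} (hD : D ∣ m) (hD0 : 0 < D) {x c : ZMod m} (hcD : D < c.val)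
    (hcD' : c.val + D ≤ m) (K : ℕ)
    (hK : ∀ s : ℕ, (x + ((D * s : ℕ) : ZMod m)).val + (-(x + ((D * s : ℕ) : ZMod m)) - c).val = K) : False := by
  have hm0 : 0 < m := NeZero.pos m
  obtain ⟨M, hM⟩ := hD
  have hM0 : 0 < M := Nat.pos_of_ne_zero (by rintro rfl; rw [mul_zero] at hM; omega)
  set q := x.val / D with hq
  set r := x.val % D with hr
  have hxv : x.val = D * q + r := (Nat.div_add_mod x.val D).symm
  have hrD : r < D := Nat.mod_lt _ hD0
  have hqM : q < M := by
    rw [hq, Nat.div_lt_iff_lt_mul hD0, mul_comm, ← hM]; exact ZMod.val_lt x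
  -- the representative of `x + D s`
  have hval : ∀ s : ℕ, (x + ((D * s : ℕ) : ZMod m)).val = (x.val + D * s) % m := fun s ↦ by
    rw [ZMod.val_add, ZMod.val_natCast, Nat.add_mod_mod]
  -- `s₁`: the point `r`
  set s₁ := M * (q + 1) - q with hs₁
  have hx₁ : (x + ((D * s₁ : ℕ) : ZMod m)).val = r := by
    have hle : D * q ≤ m * (q + 1) := by rw [hM]; nlinarith
    rw [hval, hxv, hs₁, Nat.mul_sub, show D * (M * (q + 1)) = m * (q + 1) by rw [hM]; ring,
      show D * q + r + (m * (q + 1) - D * q) = r + m * (q + 1) by omega,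
      Nat.add_mul_mod_self_left, Nat.mod_eq_of_lt (by omega)]
  -- `s₂`: the point `r + m − D`
  set s₂ := s₁ + (M - 1) with hs₂
  have hx₂ : (x + ((D * s₂ : ℕ) : ZMod m)).val = r + (m - D) := by
    have e : x + ((D * s₂ : ℕ) : ZMod m) = (x + ((D * s₁ : ℕ) : ZMod m)) + ((D * (M - 1) : ℕ) : ZMod m) := by
      rw [hs₂]; push_cast; ring
    rw [e, ZMod.val_add, hx₁, ZMod.val_natCast, Nat.mul_sub, mul_one, ← hM,
      Nat.mod_eq_of_lt (show m - D < m by omega), Nat.mod_eq_of_lt (by omega)]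
  -- the two sums
  have hK₁ := hK s₁
  have hK₂ := hK s₂
  set y₁ := x + ((D * s₁ : ℕ) : ZMod m) with hy₁
  set y₂ := x + ((D * s₂ : ℕ) : ZMod m) with hy₂
  have hc1 : (y₁ + c).val = r + c.val := by
    rw [ZMod.val_add, hx₁, Nat.mod_eq_of_lt (by omega)]
  have hc2 : (y₂ + c).val = r + c.val - D := by
    rw [ZMod.val_add, hx₂, show r + (m - D) + c.val = (r + c.val - D) + m by omega, Nat.add_mod_right,
      Nat.mod_eq_of_lt (by omega)]
  have hn1 : (-(y₁) - c).val = m - (r + c.val) := by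
    rw [show -(y₁) - c = -(y₁ + c) by ring, ZMod.neg_val, if_neg, hc1]
    intro h0
    have := congrArg ZMod.val h0
    rw [hc1, ZMod.val_zero] at this
    omega
  have hn2 : (-(y₂) - c).val = m - (r + c.val - D) := by
    rw [show -(y₂) - c = -(y₂ + c) by ring, ZMod.neg_val, if_neg, hc2]
    intro h0
    have := congrArg ZMod.val h0
    rw [hc2, ZMod.val_zero] at this
    omega
  rw [hx₁, hn1] at hK₁
  rw [hx₂, hn2] at hK₂
  omega

omit [NeZero m] in
/-- A number `≡ 1 (mod 6)` is prime to `m = 2ⁱ⁺¹3ᵏ⁺¹`. [folklore] -/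
private theorem coprime_one_add (hm : m = 6 * n) (hn : n = 2 ^ i * 3 ^ k) {D j : ℕ} (h6 : 6 ∣ D) :
    Nat.Coprime (1 + D * j) m := by
  have h2 : ¬ 2 ∣ 1 + D * j := fun h ↦ by
    have : 2 ∣ D * j := Dvd.dvd.mul_right (dvd_trans ⟨3, rfl⟩ h6) j
    omega
  have h3 : ¬ 3 ∣ 1 + D * j := fun h ↦ by
    have : 3 ∣ D * j := Dvd.dvd.mul_right (dvd_trans ⟨2, by norm_num⟩ h6) j
    omega
  rw [hm, hn, show 6 * (2 ^ i * 3 ^ k) = 2 ^ (i + 1) * 3 ^ (k + 1) by ring]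
  exact Nat.Coprime.mul_right (Nat.Coprime.pow_right _ ((Nat.Prime.coprime_iff_not_dvd Nat.prime_two).mpr h2).symm)
    (Nat.Coprime.pow_right _ ((Nat.Prime.coprime_iff_not_dvd Nat.prime_three).mpr h3).symm)

/-- **The units `1 + D·j`.** Let `m = DM`, `6 ∣ D`, `1 < M`, `x ∈ ℤ/m` with `⟨x⟩` prime to `M`. For every `s` there is a unit
`τ` of `ℤ/m` with `τ x = x + Ds` and `τ y = y` for every `y` killed by `D`. [folklore] -/
private theorem exists_shift_unit (hm : m = 6 * n) (hn : n = 2 ^ i * 3 ^ k) {D M : ℕ} (hDM : m = D * M) (h6 : 6 ∣ D)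
    (hM1 : 1 < M) {x : ZMod m} (hx : Nat.Coprime x.val M) (s : ℕ) :
    ∃ τ : (ZMod m)ˣ, (τ : ZMod m) * x = x + ((D * s : ℕ) : ZMod m) ∧
      ∀ y : ZMod m, ((D : ℕ) : ZMod m) * y = 0 → (τ : ZMod m) * y = y := by
  obtain ⟨cinv, -, hcinv⟩ := Nat.exists_mul_mod_eq_one_of_coprime hx hM1
  have hcop := coprime_one_add hm hn (j := cinv * s) h6
  refine ⟨ZMod.unitOfCoprime _ hcop, ?_, fun y hy ↦ ?_⟩
  · rw [ZMod.coe_unitOfCoprime]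
    have hdiv := Nat.div_add_mod (x.val * cinv) M
    rw [hcinv] at hdiv
    have hmz : (((D * M : ℕ)) : ZMod m) = 0 := by rw [← hDM, ZMod.natCast_self]
    have e : ((x.val : ℕ) : ZMod m) * (cinv : ZMod m) = (((M * (x.val * cinv / M) + 1 : ℕ)) : ZMod m) := by
      rw [hdiv]; push_cast; ring
    conv_lhs => rw [← ZMod.natCast_zmod_val x]
    conv_rhs => rw [← ZMod.natCast_zmod_val x]
    push_cast at e hmz ⊢
    linear_combination ((D : ZMod m)) * (s : ZMod m) * e + (s : ZMod m) * ((x.val * cinv / M : ℕ) : ZMod m) * hmz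
  · rw [ZMod.coe_unitOfCoprime]
    push_cast
    linear_combination ((cinv : ZMod m)) * (s : ZMod m) * hy

/-- `D·y = 0` in `ℤ/m` when `D = m/g` and `g ∣ ⟨y⟩`. [folklore] -/
private theorem natCast_mul_eq_zero_of_dvd {D g : ℕ} (hDg : D * g = m) {y : ZMod m} (hy : g ∣ y.val) :
    ((D : ℕ) : ZMod m) * y = 0 := by
  obtain ⟨q, hq⟩ := hy
  rw [← ZMod.natCast_zmod_val y, hq, show ((D : ℕ) : ZMod m) * (((g * q : ℕ)) : ZMod m) = (((D * g * q : ℕ)) : ZMod m) by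
    push_cast; ring, hDg]
  push_cast
  rw [ZMod.natCast_self, zero_mul]

/-- **No mixed quadruple, case (M3): `3ᵇ⁻¹ ∣ u₁, u₂` and `2ᵃ⁻¹ ∣ v₁, v₂`.** Then `u₁ + u₂ = −(v₁ + v₂) = c` with
`⟨c⟩ ∈ {n, …, 5n}` (`n = m/6`), and the units `τ = 1 + D·j` (`D = 2ᵃ·3` when `b ≥ 3`, moving `v₁` along the coset
`v₁ + Dℤ` while fixing `u₁, u₂` and `c`; `D = 2·3ᵇ` when `b = 2`, `a ≥ 5`, moving `u₁` while fixing `v₁, v₂`) give norm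
equations `⟨x + Ds⟩ + ⟨−(x + Ds) − c⟩ = const`, contradicted by `norm_shift_contra` since `D < n ≤ ⟨c⟩ ≤ 5n ≤ m − D`.
This formalisation's route to [Aoki1983, Thm. C, §9 (V)] at the levels `2ᵃ3ᵇ`. [cite: Aoki1983, Thm. C, §9 (V)]
[cite: Shioda1979PJA, §1 eq. (2)] -/
private theorem mixed_M3 (hm : m = 6 * n) (hn : n = 2 ^ i * 3 ^ k) (hi : 1 ≤ i) (hk : 1 ≤ k) (h144 : 144 < m)
    {s : Multiset (ZMod m)} (hs : IsHodgeMultiset s) (hpf : ¬ HasPair s) {u₁ u₂ v₁ v₂ : ZMod m}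
    (hsx : s = u₁ ::ₘ u₂ ::ₘ {v₁, v₂}) (hu₁ : ¬ 2 ∣ u₁.val ∧ 3 ∣ u₁.val) (hu₂ : ¬ 2 ∣ u₂.val ∧ 3 ∣ u₂.val)
    (hv₁ : 2 ∣ v₁.val ∧ ¬ 3 ∣ v₁.val) (hv₂ : 2 ∣ v₂.val ∧ ¬ 3 ∣ v₂.val) (hU₁ : 3 ^ k ∣ u₁.val) (hU₂ : 3 ^ k ∣ u₂.val)
    (hV₁ : 2 ^ i ∣ v₁.val) (hV₂ : 2 ^ i ∣ v₂.val) : False := by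
  classical
  have hn0 : 0 < n := by rw [hn]; positivity
  have h2i : (2 ^ i : ℕ) ∣ m := ⟨6 * 3 ^ k, by rw [hm, hn]; ring⟩
  have h3k : (3 ^ k : ℕ) ∣ m := ⟨6 * 2 ^ i, by rw [hm, hn]; ring⟩
  -- `c = u₁ + u₂ = −(v₁ + v₂)` has representative `nt`, `1 ≤ t ≤ 5`
  set c := u₁ + u₂ with hc
  have hsum0 := hs.1.2
  rw [hsx] at hsum0
  simp only [Multiset.insert_eq_cons, Multiset.sum_cons, Multiset.sum_singleton] at hsum0
  have hcv : c = -(v₁ + v₂) := by linear_combination hsum0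
  have dvd_add_val : ∀ {g : ℕ} (_ : g ∣ m) (a b : ZMod m), g ∣ a.val → g ∣ b.val → g ∣ (a + b).val :=
    fun hg a b ha hb ↦ by rw [ZMod.val_add, Nat.dvd_mod_iff hg]; exact dvd_add ha hb
  have h3c : 3 ^ k ∣ c.val := dvd_add_val h3k u₁ u₂ hU₁ hU₂
  have h2c : 2 ^ i ∣ c.val := by
    rw [hcv, dvd_val_neg_iff₃ h2i]
    exact dvd_add_val h2i v₁ v₂ hV₁ hV₂
  have hnc : n ∣ c.val := by
    rw [hn]
    exact Nat.Coprime.mul_dvd_of_dvd_of_dvd (Nat.Coprime.pow _ _ (by norm_num)) h2c h3c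
  have hc0 : c ≠ 0 := by
    intro h
    apply hpf
    refine ⟨u₁, by rw [hsx]; exact Multiset.mem_cons_self _ _, ?_⟩
    rw [hsx, Multiset.erase_cons_head, show -u₁ = u₂ by linear_combination -h]
    exact Multiset.mem_cons_self _ _
  have hcn : n ≤ c.val := Nat.le_of_dvd (Nat.pos_of_ne_zero fun h ↦ hc0 ((ZMod.val_eq_zero c).mp h)) hnc
  have hc5 : c.val + n ≤ m := by
    obtain ⟨t, ht⟩ := hnc
    have hlt := ZMod.val_lt c
    rw [ht] at hlt ⊢
    rw [hm] at hlt ⊢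
    have : t < 6 := by nlinarith
    nlinarith
  -- the norm equations of `s` at a unit `τ`
  have hnorm : ∀ τ : (ZMod m)ˣ, ((τ : ZMod m) * u₁).val + ((τ : ZMod m) * u₂).val + ((τ : ZMod m) * v₁).val +
      ((τ : ZMod m) * v₂).val = 2 * m := fun τ ↦ by
    have h := hs.2 τ
    rw [hsx] at h
    simp only [Multiset.insert_eq_cons, Multiset.map_cons, Multiset.map_singleton, mNormSum_cons, Multiset.card_cons,
      Multiset.card_singleton] at h
    simp only [mNormSum, Multiset.map_singleton, Multiset.sum_singleton] at h
    omega
  rcases Nat.lt_or_ge k 2 with hk1 | hk2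
  · -- `b = 2` (`k = 1`): move `u₁` with `D = 2·3ᵏ⁺¹ = 18`, `M = 2ⁱ`
    have hk' : k = 1 := by omega
    have hi4 : 4 ≤ i := by
      by_contra h
      have : 2 ^ i ≤ 2 ^ 3 := Nat.pow_le_pow_right (by norm_num) (by omega)
      rw [hm, hn, hk'] at h144
      omega
    set D := 2 * 3 ^ (k + 1) with hD
    have hDM : m = D * 2 ^ i := by rw [hm, hn, hD]; ring
    have h6D : 6 ∣ D := ⟨3 ^ k, by rw [hD]; ring⟩
    have hDn : D < n := by
      rw [hD, hn, hk']
      have : 2 ^ 4 ≤ 2 ^ i := Nat.pow_le_pow_right (by norm_num) hi4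
      omega
    have hx : Nat.Coprime u₁.val (2 ^ i) :=
      Nat.Coprime.pow_right _ (Nat.coprime_two_right.mpr (Nat.odd_iff.mpr (by have := hu₁.1; omega)))
    have hDv : ∀ v : ZMod m, 2 ^ i ∣ v.val → ((D : ℕ) : ZMod m) * v = 0 := fun v hv ↦
      natCast_mul_eq_zero_of_dvd (by rw [hDM]) hv
    refine norm_shift_contra (D := D) ⟨2 ^ i, hDM⟩ (by rw [hD]; positivity) (x := u₁) (c := -c) ?_ ?_
      (2 * m - v₁.val - v₂.val) fun t ↦ ?_
    · rw [ZMod.neg_val, if_neg hc0]; omega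
    · rw [ZMod.neg_val, if_neg hc0]; omega
    · obtain ⟨τ, hτx, hτfix⟩ := exists_shift_unit hm hn hDM h6D (Nat.one_lt_two_pow (by omega)) hx t
      have h := hnorm τ
      have e2 : (τ : ZMod m) * u₂ = -(u₁ + ((D * t : ℕ) : ZMod m)) - -c := by
        rw [show u₂ = c - u₁ by rw [hc]; ring, mul_sub, hτx, hcv, mul_neg, mul_add, hτfix v₁ (hDv v₁ hV₁),
          hτfix v₂ (hDv v₂ hV₂)]
        ring
      rw [hτx, e2, hτfix v₁ (hDv v₁ hV₁), hτfix v₂ (hDv v₂ hV₂)] at h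
      have := ZMod.val_lt v₁
      have := ZMod.val_lt v₂
      omega
  · -- `b ≥ 3` (`k ≥ 2`): move `v₁` with `D = 2ⁱ⁺¹·3`, `M = 3ᵏ`
    set D := 2 ^ (i + 1) * 3 with hD
    have hDM : m = D * 3 ^ k := by rw [hm, hn, hD]; ring
    have h6D : 6 ∣ D := ⟨2 ^ i, by rw [hD]; ring⟩
    have hDn : D < n := by
      have h9 : 9 ≤ 3 ^ k := le_trans (by norm_num : 9 ≤ 3 ^ 2) (Nat.pow_le_pow_right (by norm_num) hk2)
      have h2 : 0 < 2 ^ i := by positivity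
      rw [hD, hn, pow_succ]
      nlinarith [h9, h2]
    have hx : Nat.Coprime v₁.val (3 ^ k) :=
      Nat.Coprime.pow_right _ ((Nat.Prime.coprime_iff_not_dvd Nat.prime_three).mpr hv₁.2).symm
    have hDu : ∀ u : ZMod m, 3 ^ k ∣ u.val → ((D : ℕ) : ZMod m) * u = 0 := fun u hu ↦
      natCast_mul_eq_zero_of_dvd (by rw [hDM]) hu
    refine norm_shift_contra (D := D) ⟨3 ^ k, hDM⟩ (by rw [hD]; positivity) (x := v₁) (c := c) (by omega) (by omega)
      (2 * m - u₁.val - u₂.val) fun t ↦ ?_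
    obtain ⟨τ, hτx, hτfix⟩ := exists_shift_unit hm hn hDM h6D (Nat.one_lt_pow (by omega) (by norm_num)) hx t
    have h := hnorm τ
    have e2 : (τ : ZMod m) * v₂ = -(v₁ + ((D * t : ℕ) : ZMod m)) - c := by
      rw [show v₂ = -v₁ - c by linear_combination hcv, mul_sub, mul_neg, hτx, hc, mul_add, hτfix u₁ (hDu u₁ hU₁),
        hτfix u₂ (hDu u₂ hU₂)]
    rw [hτx, e2, hτfix u₁ (hDu u₁ hU₁), hτfix u₂ (hDu u₂ hU₂)] at h
    have := ZMod.val_lt u₁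
    have := ZMod.val_lt u₂
    omega

/-! ### Assembly: no mixed quadruple at the levels `2ᵃ3ᵇ`, `a, b ≥ 2`, `m > 144` -/

/-- The case analysis on the valuations, for a labelling with `v₃(u₁) ≤ v₃(u₂)` and `v₂(v₁) ≤ v₂(v₂)`. [folklore] -/
private theorem no_mixed_aux (hm : m = 6 * n) (hn : n = 2 ^ i * 3 ^ k) (hi : 1 ≤ i) (hk : 1 ≤ k) (h144 : 144 < m)
    (IH₂ : ∀ t : Multiset (ZMod (3 * n)), IsHodgeMultiset t → card t = 4 → ¬ HasPair t →
      IsStdMultiset (3 * n) t ∨ IsSmallLift (3 * n) t)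
    {s : Multiset (ZMod m)} (hs : IsHodgeMultiset s) (hpf : ¬ HasPair s) {u₁ u₂ v₁ v₂ : ZMod m}
    (hsx : s = u₁ ::ₘ u₂ ::ₘ {v₁, v₂}) (hu₁ : ¬ 2 ∣ u₁.val ∧ 3 ∣ u₁.val) (hu₂ : ¬ 2 ∣ u₂.val ∧ 3 ∣ u₂.val)
    (hv₁ : 2 ∣ v₁.val ∧ ¬ 3 ∣ v₁.val) (hv₂ : 2 ∣ v₂.val ∧ ¬ 3 ∣ v₂.val)
    (heu : padicValNat 3 u₁.val ≤ padicValNat 3 u₂.val) (hfv : padicValNat 2 v₁.val ≤ padicValNat 2 v₂.val) : False := by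
  haveI := Fact.mk Nat.prime_three
  haveI := Fact.mk Nat.prime_two
  have hu₁0 : u₁.val ≠ 0 := fun h ↦ hu₁.1 (by rw [h]; exact dvd_zero 2)
  have hv₁0 : v₁.val ≠ 0 := fun h ↦ hs.1.1 v₁ (by rw [hsx]; simp) ((ZMod.val_eq_zero v₁).mp h)
  set e := padicValNat 3 u₁.val with he
  set f := padicValNat 2 v₁.val with hf
  have he₁ : 3 ^ e ∣ u₁.val := pow_padicValNat_dvd
  have he₁' : ¬ 3 ^ (e + 1) ∣ u₁.val := pow_succ_padicValNat_not_dvd hu₁0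
  have he₂ : 3 ^ e ∣ u₂.val := dvd_trans (pow_dvd_pow 3 heu) pow_padicValNat_dvd
  have hf₁ : 2 ^ f ∣ v₁.val := pow_padicValNat_dvd
  have hf₁' : ¬ 2 ^ (f + 1) ∣ v₁.val := pow_succ_padicValNat_not_dvd hv₁0
  have hf₂ : 2 ^ f ∣ v₂.val := dvd_trans (pow_dvd_pow 2 hfv) pow_padicValNat_dvd
  by_cases hek : e + 1 ≤ k
  · exact mixed_M1 hm hn hi hk h144 IH₂ hs hpf hsx hu₁ hu₂ hv₁ hv₂ he₁ he₁' he₂ hek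
  by_cases hfi : f + 1 ≤ i
  · exact mixed_M2 hm hn hk hs hpf hsx hu₁ hu₂ hv₁ hv₂ hf₁ hf₁' hf₂ hfi
  have hke : k ≤ e := by omega
  have hif : i ≤ f := by omega
  exact mixed_M3 hm hn hi hk h144 hs hpf hsx hu₁ hu₂ hv₁ hv₂ (dvd_trans (pow_dvd_pow 3 hke) he₁)
    (dvd_trans (pow_dvd_pow 3 hke) he₂) (dvd_trans (pow_dvd_pow 2 hif) hf₁) (dvd_trans (pow_dvd_pow 2 hif) hf₂)

/-- **No mixed quadruple at the levels `m = 2ᵃ3ᵇ`, `a, b ≥ 2`, `m > 144`** (given the classification at level `m/2`):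
a pair-free Hodge `4`-multiset over `ℤ/m` none of whose members is prime to `m` cannot contain both an odd member and a
member prime to `3` — the hypothesis `hmix` of part II's `std_or_small_step_twoThreePower`. Such a multiset would be
`{u₁, u₂, v₁, v₂}` with `u₁, u₂` odd multiples of `3` and `v₁, v₂` even and prime to `3` (`mixed_shape`); with
`3ᵉ ∥ u₁` minimal and `2ᶠ ∥ v₁` minimal, the cases `e ≤ b − 2` (M1: `T₃ᵉ`, the hexagon at `m/3ᵉ`, twins `u₂ = u₁ + m/2`,
the twin transfer at `m/2`), `f ≤ a − 2` (M2: `T₂ᶠ`, the hexagon at `m/2ᶠ`, twins `v₂ = v₁ + m/2`, zero sum mod `3`) and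
`e ≥ b − 1`, `f ≥ a − 1` (M3: the units `1 + Dj`) are each contradictory. This is the case `N = 0`, "`G.C.D.(aᵢ, m) > 1`
for all `i`", of [Aoki1983, Thm. C, §9 (V)] — there proved for all `m` through Aoki's Thm. D; here for the levels
`2ᵃ3ᵇ` by this formalisation's route (Koblitz–Ogus relations via part I and the level transfers of [Aoki1983, Prop. 2.2]).
[cite: Aoki1983, Thm. C p. 47, §9 (V) pp. 52–54; Prop. 2.2] [cite: Shioda1982PicardFermat, Prop. 4 (Q′) p. 729] -/
theorem no_mixed_twoThreePower (hm : m = 6 * n) (hn : n = 2 ^ i * 3 ^ k) (hi : 1 ≤ i) (hk : 1 ≤ k) (h144 : 144 < m)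
    (IH₂ : ∀ t : Multiset (ZMod (3 * n)), IsHodgeMultiset t → card t = 4 → ¬ HasPair t →
      IsStdMultiset (3 * n) t ∨ IsSmallLift (3 * n) t)
    {s : Multiset (ZMod m)} (hs : IsHodgeMultiset s) (hcard : card s = 4) (hpf : ¬ HasPair s)
    (hnu : ∀ a ∈ s, 2 ∣ a.val ∨ 3 ∣ a.val) (hodd : ∃ a ∈ s, ¬ 2 ∣ a.val) (hthree : ∃ a ∈ s, ¬ 3 ∣ a.val) : False := by
  have h2m : 2 ∣ m := ⟨3 * n, by rw [hm]; ring⟩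
  have h3m : 3 ∣ m := ⟨2 * n, by rw [hm]; ring⟩
  obtain ⟨u₁, u₂, v₁, v₂, hsx, hu₁, hu₂, hv₁, hv₂⟩ := mixed_shape h2m h3m hs hcard hnu hodd hthree
  have hsx₁ : s = u₂ ::ₘ u₁ ::ₘ {v₁, v₂} := by rw [hsx, Multiset.cons_swap]
  have hsx₂ : s = u₁ ::ₘ u₂ ::ₘ {v₂, v₁} := by rw [hsx, Multiset.pair_comm]
  have hsx₃ : s = u₂ ::ₘ u₁ ::ₘ {v₂, v₁} := by rw [hsx₁, Multiset.pair_comm]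
  rcases le_total (padicValNat 3 u₁.val) (padicValNat 3 u₂.val) with heu | heu <;>
    rcases le_total (padicValNat 2 v₁.val) (padicValNat 2 v₂.val) with hfv | hfv
  · exact no_mixed_aux hm hn hi hk h144 IH₂ hs hpf hsx hu₁ hu₂ hv₁ hv₂ heu hfv
  · exact no_mixed_aux hm hn hi hk h144 IH₂ hs hpf hsx₂ hu₁ hu₂ hv₂ hv₁ heu hfv
  · exact no_mixed_aux hm hn hi hk h144 IH₂ hs hpf hsx₁ hu₂ hu₁ hv₁ hv₂ heu hfv
  · exact no_mixed_aux hm hn hi hk h144 IH₂ hs hpf hsx₃ hu₂ hu₁ hv₂ hv₁ heu hfv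

/-- **The inductive step at the levels `m = 2ᵃ3ᵇ`, `a, b ≥ 2`, `m > 144`, unconditionally in the mixed case:**
`T(m/2) ∧ T(m/3) ⟹ T(m)` — every pair-free Hodge `4`-multiset over `ℤ/m` is standard (`α_x, β_x, γ_x`) or a lift from a
level `≤ 72`, given the same at the levels `m/2 = 3n` and `m/3 = 2n` (part II's `std_or_small_step_twoThreePower` with its
hypothesis `hmix` discharged by `no_mixed_twoThreePower`). Towards [Aoki1983, Thm. C] = [Shioda1982PicardFermat, Prop. 4 (Q′)]
at the levels `2ᵃ3ᵇ` (the induction follows below). [cite: Aoki1983, Thm. C p. 47; Prop. 2.2]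
[cite: Shioda1982PicardFermat, Prop. 4 (Q′) p. 729, §2 p. 726] [cite: AokiShioda1983, Thm. (𝔅²ₘ) (ii)] -/
theorem std_or_small_of_half_third_twoThreePower (hm : m = 6 * n) (hn : n = 2 ^ i * 3 ^ k) (hi : 1 ≤ i) (hk : 1 ≤ k)
    (h144 : 144 < m)
    (IH₂ : ∀ t : Multiset (ZMod (3 * n)), IsHodgeMultiset t → card t = 4 → ¬ HasPair t →
      IsStdMultiset (3 * n) t ∨ IsSmallLift (3 * n) t)
    (IH₃ : ∀ t : Multiset (ZMod (2 * n)), IsHodgeMultiset t → card t = 4 → ¬ HasPair t →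
      IsStdMultiset (2 * n) t ∨ IsSmallLift (2 * n) t)
    {s : Multiset (ZMod m)} (hs : IsHodgeMultiset s) (hcard : card s = 4) (hpf : ¬ HasPair s) :
    IsStdMultiset m s ∨ IsSmallLift m s :=
  std_or_small_step_twoThreePower hm hn hi hk h144 IH₂ IH₃
    (fun _ hs' hcard' hpf' hnu hodd hthree ↦ no_mixed_twoThreePower hm hn hi hk h144 IH₂ hs' hcard' hpf' hnu hodd hthree)
    hs hcard hpf

end Mixed

section Vocabulary

variable {L : ℕ}

/-- **The classification carried through the induction, `T(L)`**: every pair-free Hodge `4`-multiset over `ℤ/L` is standard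
(`α_x`, `β_x`, `γ_x` for some residue `x`, `IsStdMultiset`) or a lift from a level `≤ 72` (`IsSmallLift`) — at a level `L > 72`
this is the multiset form of "every indecomposable element of `𝔅²_L` is a multiple of a standard element of a level `L/d`, or of
an element of a level `≤ 72`", i.e. [Shioda1982PicardFermat, Prop. 4 (Q′)] / [AokiShioda1983, Thm. (𝔅²ₘ) (ii)] for the primitive
ones together with the exceptional levels `12, …, 72` of [MeyerNeutsch1981Fermatquadrupel, Tabelle 1] below.
[cite: Shioda1982PicardFermat, Prop. 4 (Q′) p. 729, §2 p. 726] [cite: AokiShioda1983, Thm. (𝔅²ₘ) (ii)] -/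
def StdOrSmall (L : ℕ) : Prop :=
  ∀ t : Multiset (ZMod L), IsHodgeMultiset t → card t = 4 → ¬ HasPair t → IsStdMultiset L t ∨ IsSmallLift L t

/-- `T(L)` is void at a level `L ≤ 72` (`d = 1`). [cite: MeyerNeutsch1981Fermatquadrupel, Tabelle 1 p. 54 (levels ≤ 72)] -/
theorem stdOrSmall_of_le (hL : L ≤ 72) : StdOrSmall L :=
  fun t _ _ _ ↦ Or.inr ⟨1, one_dvd L, by omega, fun a _ ↦ one_dvd _⟩

/-! ### Primitivity: the iterated `gcd` -/

/-- The iterated `gcd` divides the initial value. [folklore] -/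
private theorem foldr_gcd_dvd_init (l : Multiset ℕ) (b : ℕ) : l.foldr Nat.gcd b ∣ b := by
  induction l using Multiset.induction_on with
  | empty => simp
  | cons a s ih => rw [Multiset.foldr_cons]; exact dvd_trans (Nat.gcd_dvd_right _ _) ih

/-- The iterated `gcd` divides every member. [folklore] -/
private theorem foldr_gcd_dvd_mem (l : Multiset ℕ) (b : ℕ) {v : ℕ} (hv : v ∈ l) : l.foldr Nat.gcd b ∣ v := by
  induction l using Multiset.induction_on with
  | empty => exact absurd hv (Multiset.notMem_zero v)
  | cons a s ih =>
    rw [Multiset.foldr_cons]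
    rcases Multiset.mem_cons.mp hv with rfl | hv'
    · exact Nat.gcd_dvd_left _ _
    · exact dvd_trans (Nat.gcd_dvd_right _ _) (ih hv')

/-- A common divisor of the members and of the initial value divides the iterated `gcd`. [folklore] -/
private theorem dvd_foldr_gcd (l : Multiset ℕ) {b d : ℕ} (hb : d ∣ b) (hl : ∀ v ∈ l, d ∣ v) : d ∣ l.foldr Nat.gcd b := by
  induction l using Multiset.induction_on with
  | empty => simpa using hb
  | cons a s ih =>
    rw [Multiset.foldr_cons]
    exact Nat.dvd_gcd (hl a (Multiset.mem_cons_self a s)) (ih fun v hv ↦ hl v (Multiset.mem_cons_of_mem hv))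

/-- **A lift from a level `≤ 72` at a level `L > 72` is imprimitive.** [cite: MeyerNeutsch1981Fermatquadrupel, (9)–(10) p. 52]
[cite: Shioda1982PicardFermat, §2 p. 726 (𝔍²ₘ(d))] -/
theorem not_isPrimitive_of_isSmallLift (hL : 72 < L) {s : Multiset (ZMod L)} (hs : IsSmallLift L s) : ¬ IsPrimitive L s := by
  rintro hprim
  obtain ⟨d, hdL, hle, hds⟩ := hs
  have hd : d ∣ (s.map ZMod.val).foldr Nat.gcd L :=
    dvd_foldr_gcd _ hdL fun v hv ↦ by
      obtain ⟨a, ha, rfl⟩ := Multiset.mem_map.mp hv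
      exact hds a ha
  rw [hprim, Nat.dvd_one] at hd
  subst hd
  omega

/-- **A multiset with a member prime to the level is primitive** (`GCD = 1`). [cite: MeyerNeutsch1981Fermatquadrupel, (9)–(10) p. 52]
[cite: Shioda1982PicardFermat, §2 p. 726 (GCD(α) = 1)] -/
theorem isPrimitive_of_coprime_mem {s : Multiset (ZMod L)} {u : ZMod L} (hu : u ∈ s) (hcop : Nat.Coprime u.val L) :
    IsPrimitive L s := by
  unfold IsPrimitive
  set g := (s.map ZMod.val).foldr Nat.gcd L with hg
  have hgL : g ∣ L := foldr_gcd_dvd_init _ _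
  have hgu : g ∣ u.val := foldr_gcd_dvd_mem _ _ (Multiset.mem_map_of_mem _ hu)
  exact Nat.eq_one_of_dvd_coprimes hcop hgu hgL

/-- **An imprimitive quadruple of a level `L ≤ 144` is a lift from a level `≤ 72`.** [cite: Shioda1982PicardFermat, §2 p. 726 (𝔍²ₘ(d) ≅ 𝔍²_{m/d}(1))] -/
theorem isSmallLift_of_not_isPrimitive [NeZero L] (hL : L ≤ 144) {s : Multiset (ZMod L)} (hs : ¬ IsPrimitive L s) :
    IsSmallLift L s := by
  set g := (s.map ZMod.val).foldr Nat.gcd L with hg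
  have hgL : g ∣ L := foldr_gcd_dvd_init _ _
  have hg0 : g ≠ 0 := fun h ↦ by
    rw [h, zero_dvd_iff] at hgL
    exact NeZero.ne L hgL
  have hg1 : g ≠ 1 := hs
  refine ⟨g, hgL, by omega, fun a ha ↦ foldr_gcd_dvd_mem _ _ (Multiset.mem_map_of_mem _ ha)⟩

/-! ### Standard quadruples are standard multisets -/

/-- A unit `t` of `ℤ/2K` is odd, so `t · K = K`. [cite: Shioda1982PicardFermat, Lemma 1 (a) p. 728 (the entry m′ of αᵢ is fixed by the units)] -/
private theorem unit_mul_half₄ {K : ℕ} [NeZero L] (hL : L = 2 * K) (t : (ZMod L)ˣ) :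
    (t : ZMod L) * ((K : ℕ) : ZMod L) = ((K : ℕ) : ZMod L) := by
  have hcop := ZMod.val_coe_unit_coprime t
  have hodd : ¬ 2 ∣ (t : ZMod L).val := fun h2 ↦ by
    have := Nat.dvd_gcd h2 (show 2 ∣ L from ⟨K, hL⟩)
    rw [Nat.Coprime.gcd_eq_one hcop] at this
    omega
  obtain ⟨c, hc⟩ : ∃ c, (t : ZMod L).val = 2 * c + 1 := ⟨(t : ZMod L).val / 2, by omega⟩
  have e : (t : ZMod L) = (((2 * c + 1 : ℕ)) : ZMod L) := by rw [← hc, ZMod.natCast_zmod_val]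
  rw [e, show (((2 * c + 1 : ℕ)) : ZMod L) * ((K : ℕ) : ZMod L) = (c : ZMod L) * ((L : ℕ) : ZMod L) + K by
    rw [hL]; push_cast; ring, ZMod.natCast_self, mul_zero, zero_add]

/-- A unit `t` of `ℤ/3K` is prime to `3`, so `t · K ∈ {K, 2K}`. [cite: Shioda1982PicardFermat, Lemma 1 (b) p. 728] -/
private theorem unit_mul_third₄ {K : ℕ} [NeZero L] (hL : L = 3 * K) (t : (ZMod L)ˣ) :
    (t : ZMod L) * ((K : ℕ) : ZMod L) = ((K : ℕ) : ZMod L) ∨ (t : ZMod L) * ((K : ℕ) : ZMod L) = 2 * ((K : ℕ) : ZMod L) := by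
  have hcop := ZMod.val_coe_unit_coprime t
  have h3 : ¬ 3 ∣ (t : ZMod L).val := fun h ↦ by
    have := Nat.dvd_gcd h (show 3 ∣ L from ⟨K, hL⟩)
    rw [Nat.Coprime.gcd_eq_one hcop] at this
    omega
  have hKK : (3 : ZMod L) * ((K : ℕ) : ZMod L) = 0 := by
    rw [show (3 : ZMod L) * ((K : ℕ) : ZMod L) = ((L : ℕ) : ZMod L) by rw [hL]; push_cast; ring, ZMod.natCast_self]
  set c := (t : ZMod L).val / 3 with hc
  have e : (t : ZMod L) = (((3 * c + (t : ZMod L).val % 3 : ℕ)) : ZMod L) := by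
    rw [hc, Nat.div_add_mod, ZMod.natCast_zmod_val]
  have hr : (t : ZMod L).val % 3 = 1 ∨ (t : ZMod L).val % 3 = 2 := by omega
  rcases hr with h | h
  · left
    rw [e, h]; push_cast
    linear_combination (c : ZMod L) * hKK
  · right
    rw [e, h]; push_cast
    linear_combination (c : ZMod L) * hKK

/-- `t·L₁ = α_t`: the unit multiple of Meyer–Neutsch's `L₁ = (1, K, K+1, 2K−2)` is Shioda's `α_t = (t, t+K, −2t, K)`.
[cite: MeyerNeutsch1981Fermatquadrupel, (13) p. 53] [cite: Shioda1982PicardFermat, Lemma 1 (a) p. 728] -/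
theorem map_unit_stdOne {K : ℕ} [NeZero L] (hL : L = 2 * K) (t : (ZMod L)ˣ) :
    (stdOne L).map (fun a ↦ (t : ZMod L) * a) = {(t : ZMod L), (t : ZMod L) + ((K : ℕ) : ZMod L), -(2 * (t : ZMod L)),
      ((K : ℕ) : ZMod L)} := by
  have hK' : L / 2 = K := by rw [hL, Nat.mul_div_cancel_left _ two_pos]
  have htK := unit_mul_half₄ hL t
  have hKK : ((K : ℕ) : ZMod L) + ((K : ℕ) : ZMod L) = 0 := by
    rw [show ((K : ℕ) : ZMod L) + ((K : ℕ) : ZMod L) = ((L : ℕ) : ZMod L) by rw [hL]; push_cast; ring, ZMod.natCast_self]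
  rw [stdOne, hK']
  simp only [Multiset.insert_eq_cons, Multiset.map_cons, Multiset.map_singleton, mul_one, mul_add, htK]
  rw [show (t : ZMod L) * (2 * ((K : ℕ) : ZMod L) - 2) = -(2 * (t : ZMod L)) by linear_combination (t : ZMod L) * hKK,
    add_comm ((K : ℕ) : ZMod L) (t : ZMod L)]
  simp only [← Multiset.singleton_add]
  abel

/-- `t·L₂ = β_t`: the unit multiple of `L₂ = (1, K+1, K+2, 2K−4)` is `β_t = (t, t+K, 2t+K, −4t)`.
[cite: MeyerNeutsch1981Fermatquadrupel, (14) p. 53] [cite: Shioda1982PicardFermat, Lemma 1 (a) p. 728] -/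
theorem map_unit_stdTwo {K : ℕ} [NeZero L] (hL : L = 2 * K) (t : (ZMod L)ˣ) :
    (stdTwo L).map (fun a ↦ (t : ZMod L) * a) = {(t : ZMod L), (t : ZMod L) + ((K : ℕ) : ZMod L),
      2 * (t : ZMod L) + ((K : ℕ) : ZMod L), -(4 * (t : ZMod L))} := by
  have hK' : L / 2 = K := by rw [hL, Nat.mul_div_cancel_left _ two_pos]
  have htK := unit_mul_half₄ hL t
  have hKK : ((K : ℕ) : ZMod L) + ((K : ℕ) : ZMod L) = 0 := by
    rw [show ((K : ℕ) : ZMod L) + ((K : ℕ) : ZMod L) = ((L : ℕ) : ZMod L) by rw [hL]; push_cast; ring, ZMod.natCast_self]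
  rw [stdTwo, hK']
  simp only [Multiset.insert_eq_cons, Multiset.map_cons, Multiset.map_singleton, mul_one, mul_add, htK]
  rw [show (t : ZMod L) * (2 * ((K : ℕ) : ZMod L) - 4) = -(4 * (t : ZMod L)) by linear_combination (t : ZMod L) * hKK,
    add_comm ((K : ℕ) : ZMod L) (t : ZMod L), show ((K : ℕ) : ZMod L) + (t : ZMod L) * 2 = 2 * (t : ZMod L) + (K : ℕ) by ring]

/-- `t·L₃ = γ_t`: the unit multiple of `L₃ = (1, R+1, 2R+1, 3R−3)` is `γ_t = (t, t+R, t+2R, −3t)` (up to the order of the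
two middle entries when `t ≡ 2 (mod 3)`). [cite: MeyerNeutsch1981Fermatquadrupel, (15) p. 53] [cite: Shioda1982PicardFermat, Lemma 1 (b) p. 728] -/
theorem map_unit_stdThree {R : ℕ} [NeZero L] (hL : L = 3 * R) (t : (ZMod L)ˣ) :
    (stdThree L).map (fun a ↦ (t : ZMod L) * a) = {(t : ZMod L), (t : ZMod L) + ((R : ℕ) : ZMod L),
      (t : ZMod L) + 2 * ((R : ℕ) : ZMod L), -(3 * (t : ZMod L))} := by
  have hR' : L / 3 = R := by rw [hL, Nat.mul_div_cancel_left _ three_pos]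
  have hRRR : (3 : ZMod L) * ((R : ℕ) : ZMod L) = 0 := by
    rw [show (3 : ZMod L) * ((R : ℕ) : ZMod L) = ((L : ℕ) : ZMod L) by rw [hL]; push_cast; ring, ZMod.natCast_self]
  rw [stdThree, hR']
  simp only [Multiset.insert_eq_cons, Multiset.map_cons, Multiset.map_singleton, mul_one, mul_add, mul_sub]
  rw [show (t : ZMod L) * (3 * ((R : ℕ) : ZMod L)) - (t : ZMod L) * 3 = -(3 * (t : ZMod L)) by
    linear_combination (t : ZMod L) * hRRR, show (t : ZMod L) * (2 * ((R : ℕ) : ZMod L)) = 2 * ((t : ZMod L) * (R : ℕ)) by ring]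
  rcases unit_mul_third₄ hL t with e | e
  · rw [e, add_comm ((R : ℕ) : ZMod L), add_comm (2 * ((R : ℕ) : ZMod L))]
  · rw [e, show 2 * (2 * ((R : ℕ) : ZMod L)) = (R : ℕ) by linear_combination hRRR, add_comm (2 * ((R : ℕ) : ZMod L)),
      add_comm ((R : ℕ) : ZMod L)]
    simp only [← Multiset.singleton_add]
    abel

/-- **A standard quadruple (unit multiple of `L₁`, `L₂`, `L₃`) is a standard multiset** `α_t`, `β_t`, `γ_t`.
[cite: MeyerNeutsch1981Fermatquadrupel, (13)–(15) p. 53] [cite: Shioda1982PicardFermat, Lemma 1 (a), (b) p. 728] -/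
theorem isStdMultiset_of_isStandardQuadruple [NeZero L] {s : Multiset (ZMod L)} (h : IsStandardQuadruple L s) :
    IsStdMultiset L s := by
  obtain ⟨t, ⟨h2, h12⟩ | ⟨h3, hγ⟩⟩ := h
  · obtain ⟨K, hK⟩ := h2
    have hK' : L / 2 = K := by rw [hK, Nat.mul_div_cancel_left _ two_pos]
    refine ⟨(t : ZMod L), Or.inl ⟨⟨K, hK⟩, ?_⟩⟩
    rw [hK']
    rcases h12 with h | h
    · exact Or.inl (by rw [h, map_unit_stdOne hK])
    · exact Or.inr (by rw [h, map_unit_stdTwo hK])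
  · obtain ⟨R, hR⟩ := h3
    have hR' : L / 3 = R := by rw [hR, Nat.mul_div_cancel_left _ three_pos]
    refine ⟨(t : ZMod L), Or.inr ⟨⟨R, hR⟩, ?_⟩⟩
    rw [hR', hγ, map_unit_stdThree hR]

/-- **`T(L)` at a level `L ≤ 144` without exceptional quadruples.** [cite: Shioda1982PicardFermat, Prop. 4 (Q′) p. 729, §2 p. 726] -/
theorem stdOrSmall_of_forall_not_isExceptionalQuadruple [NeZero L] (hL : L ≤ 144)
    (hno : ∀ s : Multiset (ZMod L), ¬ IsExceptionalQuadruple L s) : StdOrSmall L := by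
  intro t ht hcard hpf
  by_cases hprim : IsPrimitive L t
  · by_cases hstd : IsStandardQuadruple L t
    · exact Or.inl (isStdMultiset_of_isStandardQuadruple hstd)
    · exact absurd ⟨hcard, ht, hpf, hprim, hstd⟩ (hno t)
  · exact Or.inr (isSmallLift_of_not_isPrimitive hL hprim)

/-- **`T(108)`**: no row `108` in [MeyerNeutsch1981Fermatquadrupel, Tabelle 1] (`ExceptionalQuadruplesCompleteLeOneHundredEighty`).
[cite: MeyerNeutsch1981Fermatquadrupel, Tabelle 1 p. 54] [cite: Shioda1982PicardFermat, table p. 727] -/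
theorem stdOrSmall_108 : StdOrSmall 108 :=
  stdOrSmall_of_forall_not_isExceptionalQuadruple (by norm_num)
    (not_isExceptionalQuadruple_of_le_oneHundredEighty 108 (by norm_num) (by norm_num) rfl)

/-- **`T(144)`**: no row `144` in [MeyerNeutsch1981Fermatquadrupel, Tabelle 1].
[cite: MeyerNeutsch1981Fermatquadrupel, Tabelle 1 p. 54] [cite: Shioda1982PicardFermat, table p. 727] -/
theorem stdOrSmall_144 : StdOrSmall 144 :=
  stdOrSmall_of_forall_not_isExceptionalQuadruple (by norm_num)
    (not_isExceptionalQuadruple_of_le_oneHundredEighty 144 (by norm_num) (by norm_num) rfl)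

end Vocabulary

/-! ### The induction on `a + b` -/

section Induction

/-- The levels `2ᵃ3ᵇ ≤ 144` with `a, b ≥ 2` are `36, 72, 108, 144`. [folklore] -/
private theorem stdOrSmall_small {a b : ℕ} (ha : 2 ≤ a) (hb : 2 ≤ b) (h : 2 ^ a * 3 ^ b ≤ 144) : StdOrSmall (2 ^ a * 3 ^ b) := by
  have ha4 : a ≤ 4 := by
    by_contra h5
    have : 2 ^ 5 ≤ 2 ^ a := Nat.pow_le_pow_right (by norm_num) (by omega)
    have : 3 ^ 2 ≤ 3 ^ b := Nat.pow_le_pow_right (by norm_num) hb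
    nlinarith
  have hb3 : b ≤ 3 := by
    by_contra h4
    have : 3 ^ 4 ≤ 3 ^ b := Nat.pow_le_pow_right (by norm_num) (by omega)
    have : 2 ^ 2 ≤ 2 ^ a := Nat.pow_le_pow_right (by norm_num) ha
    nlinarith
  interval_cases a <;> interval_cases b
  · exact stdOrSmall_of_le (by norm_num)
  · rw [show 2 ^ 2 * 3 ^ 3 = 108 by norm_num]; exact stdOrSmall_108
  · exact stdOrSmall_of_le (by norm_num)
  · exfalso; norm_num at h
  · rw [show 2 ^ 4 * 3 ^ 2 = 144 by norm_num]; exact stdOrSmall_144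
  · exfalso; norm_num at h

/-- **The towers `2ᵃ3ᵇ` reduce to their two edges.** If `T` holds at every level `2·3ᵇ` (`b ≥ 2`) and at every level `2ᵃ·3`
(`a ≥ 2`), then `T(2ᵃ3ᵇ)` for all `a, b ≥ 2`: every pair-free Hodge `4`-multiset over `ℤ/2ᵃ3ᵇ` is `α_x`, `β_x`, `γ_x` or a
lift from a level `≤ 72`. By induction on `a + b` through `std_or_small_of_half_third_twoThreePower` (parts I–III); the base
levels `36, 72, 108, 144` come from [MeyerNeutsch1981Fermatquadrupel, Tabelle 1] as kernel-checked in
`ExceptionalQuadruplesCompleteLeOneHundredEighty`. This is [Aoki1983, Thm. C] = [Shioda1982PicardFermat, Prop. 4 (Q′)] at the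
levels `2ᵃ3ᵇ`, `a, b ≥ 2`, conditionally on the same statement at the edge levels `2·3ᵇ`, `2ᵃ·3` (where part I's engine does
not apply: no `2`-closure of `Φ` at `a = 1`, no hexagon at `b = 1`). [cite: Aoki1983, Thm. C p. 47]
[cite: Shioda1982PicardFermat, Prop. 4 (Q′) p. 729] [cite: AokiShioda1983, Thm. (𝔅²ₘ) (ii)] -/
theorem stdOrSmall_twoThreePower (H₁ : ∀ b : ℕ, 2 ≤ b → StdOrSmall (2 * 3 ^ b))
    (H₂ : ∀ a : ℕ, 2 ≤ a → StdOrSmall (2 ^ a * 3)) {a b : ℕ} (ha : 2 ≤ a) (hb : 2 ≤ b) : StdOrSmall (2 ^ a * 3 ^ b) := by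
  -- strong induction on `a + b`
  suffices key : ∀ N a b : ℕ, a + b = N → 2 ≤ a → 2 ≤ b → StdOrSmall (2 ^ a * 3 ^ b) from key _ a b rfl ha hb
  intro N
  induction N using Nat.strong_induction_on with
  | _ N ih =>
  intro a b hab ha hb
  by_cases h144 : 2 ^ a * 3 ^ b ≤ 144
  · exact stdOrSmall_small ha hb h144
  push Not at h144
  obtain ⟨a', rfl⟩ := Nat.exists_eq_add_of_le' ha
  obtain ⟨b', rfl⟩ := Nat.exists_eq_add_of_le' hb
  haveI : NeZero (2 ^ (a' + 2) * 3 ^ (b' + 2)) := ⟨by positivity⟩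
  set n := 2 ^ (a' + 1) * 3 ^ (b' + 1) with hn
  have hm : 2 ^ (a' + 2) * 3 ^ (b' + 2) = 6 * n := by rw [hn]; ring
  -- `T(m/2)`: the level `3n = 2ᵃ⁻¹3ᵇ`
  have IH₂ : StdOrSmall (3 * n) := by
    have e : 3 * n = 2 ^ (a' + 1) * 3 ^ (b' + 2) := by rw [hn]; ring
    rw [e]
    rcases Nat.lt_or_ge a' 1 with h0 | h1
    · have : a' = 0 := by omega
      subst this
      simpa using H₁ (b' + 2) (by omega)
    · exact ih (a' + 1 + (b' + 2)) (by omega) (a' + 1) (b' + 2) rfl (by omega) (by omega)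
  -- `T(m/3)`: the level `2n = 2ᵃ3ᵇ⁻¹`
  have IH₃ : StdOrSmall (2 * n) := by
    have e : 2 * n = 2 ^ (a' + 2) * 3 ^ (b' + 1) := by rw [hn]; ring
    rw [e]
    rcases Nat.lt_or_ge b' 1 with h0 | h1
    · have : b' = 0 := by omega
      subst this
      simpa using H₂ (a' + 2) (by omega)
    · exact ih (a' + 2 + (b' + 1)) (by omega) (a' + 2) (b' + 1) rfl (by omega) (by omega)
  intro t ht hcard hpf
  exact std_or_small_of_half_third_twoThreePower hm hn (by omega) (by omega) h144 IH₂ IH₃ ht hcard hpf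

end Induction

/-! ### `Δ(2ᵃ3ᵇ) = 0` and the letter of Theorem C at the levels `2ᵃ3ᵇ`, `a, b ≥ 2` -/

section Exceptional

variable {m : ℕ} [NeZero m]

/-- A prime factor of a member of a standard multiset through a unit-free parameter `x` divides everything: for a primitive
`α_x`, `β_x` (`4 ∣ m`) or `γ_x` (`9 ∣ m`), `x` is prime to `m`. [cite: Shioda1982PicardFermat, §2 p. 726 (GCD), Lemma 1 p. 728] -/
private theorem coprime_of_isStdMultiset_of_isPrimitive (h4 : 4 ∣ m) (h9 : 9 ∣ m) {s : Multiset (ZMod m)}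
    (hprim : IsPrimitive m s) {x : ZMod m}
    (hx : s = {x, x + ((m / 2 : ℕ) : ZMod m), -(2 * x), ((m / 2 : ℕ) : ZMod m)} ∨
      s = {x, x + ((m / 2 : ℕ) : ZMod m), 2 * x + ((m / 2 : ℕ) : ZMod m), -(4 * x)} ∨
      s = {x, x + ((m / 3 : ℕ) : ZMod m), x + 2 * ((m / 3 : ℕ) : ZMod m), -(3 * x)}) :
    Nat.Coprime x.val m := by
  rw [Nat.coprime_iff_gcd_eq_one]
  by_contra hg
  obtain ⟨p, hp, hpg⟩ := Nat.exists_prime_and_dvd hg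
  have hpx : p ∣ x.val := dvd_trans hpg (Nat.gcd_dvd_left _ _)
  have hpm : p ∣ m := dvd_trans hpg (Nat.gcd_dvd_right _ _)
  -- `p` divides `m/2` and `m/3`
  obtain ⟨K, hK⟩ : 2 ∣ m := dvd_trans ⟨2, by norm_num⟩ h4
  obtain ⟨R, hR⟩ : 3 ∣ m := dvd_trans ⟨3, by norm_num⟩ h9
  have hK' : m / 2 = K := by rw [hK, Nat.mul_div_cancel_left _ two_pos]
  have hR' : m / 3 = R := by rw [hR, Nat.mul_div_cancel_left _ three_pos]
  have hpK : p ∣ K := by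
    have h2K : 2 ∣ K := by obtain ⟨c, hc⟩ := h4; exact ⟨c, by omega⟩
    rcases (Nat.Prime.dvd_mul hp).mp (hK ▸ hpm) with h | h
    · rw [(Nat.prime_dvd_prime_iff_eq hp Nat.prime_two).mp h]; exact h2K
    · exact h
  have hpR : p ∣ R := by
    have h3R : 3 ∣ R := by obtain ⟨c, hc⟩ := h9; exact ⟨c, by omega⟩
    rcases (Nat.Prime.dvd_mul hp).mp (hR ▸ hpm) with h | h
    · rw [(Nat.prime_dvd_prime_iff_eq hp Nat.prime_three).mp h]; exact h3R
    · exact h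
  -- `p` divides the representative of every member: reduce modulo `p`
  set ρ := ZMod.castHom hpm (ZMod p) with hρ
  have castp : ∀ y : ZMod m, p ∣ y.val ↔ ρ y = 0 := fun y ↦ by
    rw [ZMod.castHom_apply, ZMod.cast_eq_val, ZMod.natCast_eq_zero_iff]
  have ρx : ρ x = 0 := (castp x).mp hpx
  have ρK : ρ (((m / 2 : ℕ)) : ZMod m) = 0 := by rw [hK', map_natCast, ZMod.natCast_eq_zero_iff]; exact hpK
  have ρR : ρ (((m / 3 : ℕ)) : ZMod m) = 0 := by rw [hR', map_natCast, ZMod.natCast_eq_zero_iff]; exact hpR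
  have hall : ∀ a ∈ s, p ∣ a.val := by
    intro a ha
    rw [castp]
    rcases hx with e | e | e <;> rw [e] at ha <;>
      simp only [Multiset.insert_eq_cons, Multiset.mem_cons, Multiset.mem_singleton] at ha <;>
      rcases ha with rfl | rfl | rfl | rfl <;>
      simp [_root_.map_add, _root_.map_neg, _root_.map_mul, ρx, ρK, ρR]
  have hdiv : p ∣ (s.map ZMod.val).foldr Nat.gcd m :=
    dvd_foldr_gcd _ hpm fun v hv ↦ by
      obtain ⟨a, ha, rfl⟩ := Multiset.mem_map.mp hv
      exact hall a ha
  rw [hprim, Nat.dvd_one] at hdiv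
  exact hp.one_lt.ne' hdiv

/-- **A primitive standard multiset is a standard quadruple** (`4 ∣ m`, `9 ∣ m`): `α_x = x·L₁`, `β_x = x·L₂`, `γ_x = x·L₃` with
`x` a unit. [cite: MeyerNeutsch1981Fermatquadrupel, (13)–(15) p. 53] [cite: Shioda1982PicardFermat, Lemma 1 (a), (b) p. 728] -/
theorem isStandardQuadruple_of_isStdMultiset_of_isPrimitive (h4 : 4 ∣ m) (h9 : 9 ∣ m) {s : Multiset (ZMod m)}
    (hstd : IsStdMultiset m s) (hprim : IsPrimitive m s) : IsStandardQuadruple m s := by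
  obtain ⟨x, hx⟩ := hstd
  have hx' : s = {x, x + ((m / 2 : ℕ) : ZMod m), -(2 * x), ((m / 2 : ℕ) : ZMod m)} ∨
      s = {x, x + ((m / 2 : ℕ) : ZMod m), 2 * x + ((m / 2 : ℕ) : ZMod m), -(4 * x)} ∨
      s = {x, x + ((m / 3 : ℕ) : ZMod m), x + 2 * ((m / 3 : ℕ) : ZMod m), -(3 * x)} := by
    rcases hx with ⟨-, h | h⟩ | ⟨-, h⟩
    · exact Or.inl h
    · exact Or.inr (Or.inl h)
    · exact Or.inr (Or.inr h)
  have hcop := coprime_of_isStdMultiset_of_isPrimitive h4 h9 hprim hx'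
  set t := ZMod.unitOfCoprime x.val hcop with ht
  have htx : (t : ZMod m) = x := by rw [ht, ZMod.coe_unitOfCoprime, ZMod.natCast_zmod_val]
  obtain ⟨K, hK⟩ : 2 ∣ m := dvd_trans ⟨2, by norm_num⟩ h4
  obtain ⟨R, hR⟩ : 3 ∣ m := dvd_trans ⟨3, by norm_num⟩ h9
  have hK' : m / 2 = K := by rw [hK, Nat.mul_div_cancel_left _ two_pos]
  have hR' : m / 3 = R := by rw [hR, Nat.mul_div_cancel_left _ three_pos]
  rcases hx with ⟨h2, h | h⟩ | ⟨h3, h⟩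
  · refine ⟨t, Or.inl ⟨h2, Or.inl ?_⟩⟩
    rw [map_unit_stdOne hK, htx, h, hK']
  · refine ⟨t, Or.inl ⟨h2, Or.inr ?_⟩⟩
    rw [map_unit_stdTwo hK, htx, h, hK']
  · refine ⟨t, Or.inr ⟨h3, ?_⟩⟩
    rw [map_unit_stdThree hR, htx, h, hR']

/-- **`Δ(m) = 0` at the levels `m = 2ᵃ3ᵇ`, `a, b ≥ 2`, `m > 72`, given `T` on the edges**: no exceptional quadruple — every
indecomposable primitive Hodge quadruple is standard ([Shioda1982PicardFermat, Prop. 4 (Q′)]; `Δ(m) = 0` in the notation of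
Shioda's table p. 727, extended beyond `180`). Conditional on `T(2·3ᵇ′)`, `T(2ᵃ′·3)` for all `a′, b′ ≥ 2` (the edge families
of the tower, not treated in this series). [cite: Shioda1982PicardFermat, Prop. 4 (Q′) p. 729, table p. 727]
[cite: Aoki1983, Thm. C p. 47] [cite: MeyerNeutsch1981Fermatquadrupel, p. 53 (Standard- und Ausnahmequadrupel)] -/
theorem not_isExceptionalQuadruple_twoThreePower (H₁ : ∀ b : ℕ, 2 ≤ b → StdOrSmall (2 * 3 ^ b))
    (H₂ : ∀ a : ℕ, 2 ≤ a → StdOrSmall (2 ^ a * 3)) {a b : ℕ} (hm : m = 2 ^ a * 3 ^ b) (ha : 2 ≤ a) (hb : 2 ≤ b)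
    (h72 : 72 < m) (s : Multiset (ZMod m)) : ¬ IsExceptionalQuadruple m s := by
  rintro ⟨hcard, hs, hpf, hprim, hns⟩
  have key : StdOrSmall m := by rw [hm]; exact stdOrSmall_twoThreePower H₁ H₂ ha hb
  obtain ⟨a', rfl⟩ := Nat.exists_eq_add_of_le' ha
  obtain ⟨b', rfl⟩ := Nat.exists_eq_add_of_le' hb
  have h4 : 4 ∣ m := ⟨2 ^ a' * 3 ^ (b' + 2), by rw [hm]; ring⟩
  have h9 : 9 ∣ m := ⟨2 ^ (a' + 2) * 3 ^ b', by rw [hm]; ring⟩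
  rcases key s hs hcard hpf with hstd | hsmall
  · exact hns (isStandardQuadruple_of_isStdMultiset_of_isPrimitive h4 h9 hstd hprim)
  · exact not_isPrimitive_of_isSmallLift h72 hsmall hprim

/-- **The letter of [AokiShioda1983, Thm. (𝔅²ₘ) (ii)] = [Aoki1983, Thm. C] at the levels `m = 2ᵃ3ᵇ`, `a, b ≥ 2`, `m > 72`,
given `T` on the edges** — the body of the named fact `HodgeTheory.AokiShioda1983_thmB2m_standard` at these levels
(`letter_of_forall_not_isExceptionalQuadruple`). [cite: AokiShioda1983, §2 Thm. (𝔅²ₘ) (ii) a), b), c), p. 3]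
[cite: Aoki1983, Thm. C p. 47] -/
theorem thmB2m_standard_twoThreePower (H₁ : ∀ b : ℕ, 2 ≤ b → StdOrSmall (2 * 3 ^ b))
    (H₂ : ∀ a : ℕ, 2 ≤ a → StdOrSmall (2 ^ a * 3)) {a b : ℕ} (hm : m = 2 ^ a * 3 ^ b) (ha : 2 ≤ a) (hb : 2 ≤ b)
    (h72 : 72 < m) (α : Fin 4 → ZMod m) (hα : IsHodge α) (hind : ∀ i j : Fin 4, i ≠ j → α i + α j ≠ 0)
    (hprim : ∀ g : ℕ, (∀ i, g ∣ (α i).val) → g = 1) :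
    ∃ σ : Equiv.Perm (Fin 4),
      (∃ d i : ℕ, m = 2 * d ∧ 1 ≤ i ∧ i < d ∧ Nat.Coprime i d ∧ 4 * i ≠ m ∧
          ∀ k, α (σ k) = ![(i : ZMod m), (d : ZMod m) + i, -(2 * (i : ZMod m)), (d : ZMod m)] k) ∨
      (∃ d i : ℕ, m = 2 * d ∧ 1 ≤ i ∧ i < d ∧ Nat.Coprime i d ∧ 3 * i ≠ m ∧ 4 * i ≠ m ∧ 6 * i ≠ m ∧
          ∀ k, α (σ k) =
            ![(i : ZMod m), (d : ZMod m) + i, (d : ZMod m) + 2 * i, -(4 * (i : ZMod m))] k) ∨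
      (∃ d j : ℕ, m = 3 * d ∧ 1 ≤ j ∧ j < d ∧ Nat.Coprime j d ∧ 6 * j ≠ m ∧
          ∀ k, α (σ k) =
            ![(j : ZMod m), (d : ZMod m) + j, 2 * (d : ZMod m) + j, -(3 * (j : ZMod m))] k) :=
  letter_of_forall_not_isExceptionalQuadruple (not_isExceptionalQuadruple_twoThreePower H₁ H₂ hm ha hb h72) α hα hind hprim

end Exceptional

end Literature.AlgebraicGeometry.Shioda1982
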